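import Literature.Topology.FourManifolds.TrisectionFunctorSPC4
import Literature.Topology.FourManifolds.TrisectionFunctorGKVanKampen
import Literature.Topology.FourManifolds.TrisectionFunctorGKNaturality
import Literature.Topology.FourManifolds.TrisectionStabilizationDatum
import Literature.Topology.FourManifolds.FlowerMelon
import Literature.Topology.FourManifolds.TrisectionEulerProofs
import Literature.Topology.FourManifolds.SPC4Wave0Proofs
import Literature.Topology.FourManifolds.SimplyConnectedSecondHomology
import Literature.AlgebraicTopology.SingularHomology.KroneckerDegreeOne
import Literature.AlgebraicTopology.SingularHomology.FundamentalClassExistence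
import Literature.AlgebraicTopology.SingularHomology.FundamentalClassProofs
import HarnessLib

/-!
# Proofs for `TrisectionFunctorSPC4.lean`: Gay–Kirby's Remark 2 in full, and the discharge of leaf (h)

Sibling proof file of `Literature/Topology/FourManifolds/TrisectionFunctorSPC4.lean` (the assembly
of Abrams–Gay–Kirby 2018, Cor. 6: *SPC4 ⟺ "every `(3k, k)`-trisection of the trivial group is
stably trivial"*, `Literature.Topology.FourManifolds.spc4_iff_forall_isStablyTrivial`, from ten
named leaves), written by the fact seat
`provefact-Literature.Topology.FourManifolds.spc4_i-6271d7c331` (D-0014: a named fact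
`def X : Prop` is discharged as `theorem X_holds : X`).  It contains only theorems.

## 1. Gay–Kirby 2016, Remark 2, PROVED for every trisected closed 4-manifold

D. Gay, R. Kirby, *Trisecting 4-manifolds*, Geom. Topol. 20 (2016), Remark 2 (p. 3098; arXiv
p. 3): *"Note that the triple intersection `X₁ ∩ X₂ ∩ X₃` is a surface of genus `g` and that
`χ(X) = 2 + g − 3k`. Thus `k` is determined by `X` and `g`."*; unbalanced form
`χ(X) = 2 + g − k₁ − k₂ − k₃` (Meier–Schirmer–Zupan 2016, before Remark 3.12).
`Literature.Topology.FourManifolds.relEuler_of_gkTrisection`: for a compact Hausdorff smooth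
4-manifold `X : Type u` with a `(g; k₀, k₁, k₂)`-trisection `S` in the sense of
`IsGKTrisection` (sectors with corners along the central surface), the integral singular homology
of `X` is finitely generated and vanishes from degree `5` on, and
`χ(X) = Σ_{j<5} (−1)ʲ rank H_j(X; ℤ) = 2 + g − (k₀ + k₁ + k₂)`.
The proof is the inclusion–exclusion of `TrisectionEulerProofs.lean` (there run for `X ≃ S⁴`,
where `χ(X) = 2` was the input and `g = Σ kᵢ` the output): rational Čech Euler characteristics
of the compact pieces (`Cech.euler_union₃`), tautness (`finCech_and_euler_of_homeomorph`), the
Morse equalities `χ(X_i) = 1 − kᵢ`, `χ(H_{ij}) = 1 − g`, `χ(F_g) = 2 − 2g`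
(`relEuler_of_handleCount`, `relEuler_boundary_of_handleCount`), now with `χ̌(X; ℚ) = χ(X; ℤ)`
supplied by the finiteness of the homology of a closed topological manifold
(`finite_singularHomology_of_compactSpace_holds`, `isZero_singularHomology_of_lt_holds`,
Hatcher Cor. A.8–A.9 and Thm. 3.26(c), both PROVED in the tree) instead of `X ≃ S⁴`.

## 2. Leaf (h) of Cor. 6 discharged: `isZero_singularHomologyZ_two_of_gkTrisection_three_mul_holds`

A. Abrams, D. Gay, R. Kirby, *Group trisections and smooth 4-manifolds*, Geom. Topol. 22 (2018),
proof of Cor. 6 (p. 1541): *"The Euler characteristic of a `(g, k)`-trisected 4-manifold is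
`2 − g + 3k` [sic; `2 + g − 3k`, GK Remark 2 — both equal `2` at `g = 3k`], so in this case we
have an Euler characteristic `2` simply connected 4-manifold, i.e. a homotopy `S⁴`."*  The named
fact (h) of `TrisectionFunctorSPC4.lean` is the homological content of "Euler characteristic `2`
simply connected": `H₂(X; ℤ) = 0`.  Proof here, for `X : Type u` in every universe: by §1,
`rank H₀ − rank H₁ + rank H₂ − rank H₃ + rank H₄ = 2 + 3k − 3k = 2`; `rank H₀ = 1` (`X` is path
connected, Hatcher Prop. 2.7); `H₁ = 0` (Hurewicz in degree one, Thm. 2A.1,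
`isZero_singularHomology_one_of_simplyConnectedSpace`); `X` is `ℤ`-orientable (simply connected,
Prop. 3.25, `OrientationCover.nonempty_homologicalOrientation` with
`nonempty_localHomology_iso_holds'`), so `H₄ ≅ ℤ` (Thm. 3.26(a),
`nonempty_singularHomology_top_iso_holds`) and, by **Poincaré duality** (Thm. 3.30, PROVED:
`poincare_duality`), `H₃ ≅ H¹ = 0` (`H¹ ≅ Hom(H₁, ℤ)`, Thm. 3.2,
`isZero_singularCohomology_one_of_simplyConnectedSpace`) and `H₂ ≅ H²`, which is torsion-free
(Cor. 3.3, `torsion_singularCohomology_two_eq_bot`) and finitely generated; hence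
`rank H₂ = 0` and `H₂(X; ℤ) = 0`.

## 3. The assembly of Cor. 6 with the proved leaves fed in

`Literature.Topology.FourManifolds.spc4_iff_forall_isStablyTrivial_of_leaves`: the named fact (f)
`spc4_iff_forall_isStablyTrivial` (every universe) from the SEVEN remaining unproved leaves —
Gay–Kirby Thm. 4 (`exists_isBalancedGKTrisection`), the marking fact (g′), the parts (a′), (b′),
(c′), (e′) of AGK Thm. 5, and (i) = AGK Thm. 5 with GK Thm. 11 — the other three hypotheses of
`spc4_iff_forall_isStablyTrivial_of_facts_univ` being discharged by
`gkTrisection_genus_eq_sum_of_homotopyEquiv_sphere_holds` (`TrisectionEulerProofs.lean`),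
`isZero_singularHomologyZ_two_of_gkTrisection_three_mul_holds` (this file) and
`nonempty_homotopyEquiv_sphere_four_iff_holds` (`SPC4Wave0Proofs.lean`).  The unconditional
`spc4_iff_forall_isStablyTrivial_holds` still needs those seven leaves (Cerf theory,
Laudenbach–Poénaru, Waldhausen, `π₁(Σ_g)`), none of which is in the tree.
(Update, 2026-08-15: (a′) has since been discharged upstream, see §4.)

## 4. Six leaves: (a′) fed by `isGroupTrisection_groupGKTrisectionOf_holds`

`Literature.Topology.FourManifolds.spc4_iff_forall_isStablyTrivial_of_six_leaves`: the same
assembly with hypothesis (a′) — the kernel triple `𝒢(X, T, μ)` of a balanced trisection is a group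
trisection of `π₁(X, x₀)` (AGK p. 1540, the map `𝒢`) — discharged by
`isGroupTrisection_groupGKTrisectionOf_holds` (`TrisectionFunctorGKVanKampen.lean`: van Kampen for
the three sectors with collars along the handlebodies, `π₁` of `1`-handlebodies and of their
boundaries).  SIX named leaves remain before `spc4_iff_forall_isStablyTrivial_holds`: Gay–Kirby
Thm. 4 (`exists_isBalancedGKTrisection`), (g′) `exists_marking_centralSurface_of_gkTrisection`,
(b′) `diffeomorph_of_iso_groupGKTrisectionOf`, (c′) `exists_stabilized_gkTrisection`,
(e′) `exists_gkTrisected_of_isGroupTrisection`, (i) `stablyIso_groupGKTrisectionOf_of_diffeomorphic`.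

## 5. Leaf (i) reduced to one manifold (Gay–Kirby Thm. 11 in `𝒢`-form)

`Literature.Topology.FourManifolds.stablyIso_groupGKTrisectionOf_of_diffeomorphic_of_sameManifold`:
the named fact (i) — diffeomorphic trisected 4-manifolds have stably isomorphic kernel triples
(AGK Thm. 5, last sentence, via GK Thm. 11) — follows from its case `X = X'`: *two balanced
trisections of one closed connected oriented smooth 4-manifold have stably isomorphic kernel
triples, for all base points and markings*, which is exactly the `𝒢`-image of Gay–Kirby's
Thm. 11 ("any two trisections of the same 4-manifold become isotopic after performing some number
of connected sums with the standard `(3, 1)`-trisection of `S⁴`", quoted by AGK p. 1542) together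
with AGK's compatibility of `ℳ`/`𝒢` with stabilisation.  Proof of the reduction: carry the
trisection of `X'` back to `X` along the diffeomorphism (`IsGKTrisection.image_diffeomorph`,
Gay–Kirby's Def. 1 is natural) with the transported base point and marking, which have the same
kernel triple (`exists_groupGKTrisectionOf_eq_of_homeomorph`, AGK p. 1540), both from
`TrisectionFunctorGKNaturality.lean`.  The single-manifold statement is a HYPOTHESIS of the
reduction theorem (it is not vendored as a named fact); GK Thm. 11 itself (Cerf theory of Morse
2-functions) is not in the tree.

## 6. `𝒢` is well defined up to isomorphism

`Literature.Topology.FourManifolds.groupGKTrisectionOf_iso`: for one Gay–Kirby trisection `S` of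
`X`, any two base points of the central surface `F` and any two markings give isomorphic kernel
triples (`TrisectionKernels.Iso`) — `F` is path connected, transport of the marking along a path in
`F` does not change the kernel triple (`groupGKTrisectionOf_transport`,
`TrisectionStabilizationDatum.lean`; Hatcher Prop. 1.5), and two markings at one base point differ
by an automorphism of `S_g` (`groupGKTrisectionOf_iso_of_markings`).  This is the precise sense of
AGK's "𝒢 … up to trisected isomorphism" (p. 1540, Thm. 5) for the kernel-triple form of `𝒢`.
With the genus bookkeeping `groupGKTrisectionOf_iso_cast`, `TrisectionKernels.Iso.cast_congr`.

## 7.–8. Leaf (i) from Gay–Kirby's Thm. 11, for any stabilisation relation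

`Literature.Topology.FourManifolds.stablyIso_groupGKTrisectionOf_of_diffeomorphic_of_uniqueness`:
leaf (i) follows — for an ARBITRARY relation `Stab X n S Sₙ` ("`Sₙ` is an `n`-fold stabilisation
of `S`", GK Def. 8) — from (`hStab`) the `𝒢`-compatibility of `Stab` with the algebraic
stabilisation for all based markings, up to isomorphism (AGK Thm. 5: "connected sums of group
trisections map to connected sums of 4-manifold trisections"; proof, p. 1542: "constructed
exactly to correspond to stabilization of manifolds") and (`hGK11`) Gay–Kirby's Thm. 11 for
`Stab` ("after stabilizing each trisection some number of times, there is a diffeomorphism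
`h : X → X` isotopic to the identity with the property that `h(Xᵢ) = Xᵢ'`"; "isotopic to the
identity" is not needed, the genus bookkeeping `g' + 3n' = g + 3n` is made explicit).  Proof: §5
(one manifold), `hGK11`, `hStab` on both sides, naturality of `𝒢` under `ψ`
(`exists_groupGKTrisectionOf_eq_of_homeomorph`) and §6 on the common stabilised trisection.
§8, `stablyIso_groupGKTrisectionOf_of_diffeomorphic_of_oneMarking`: `hStab` itself follows from
its ONE-marking, on-the-nose form (the shape of the geometric computation of
`TrisectionStabilizationDatum.lean`) and Nielsen's lifting theorem for automorphisms of `S_g`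
(hypothesis `hN`, the liftability condition of `TrisectionKernels.Iso.stabilize_of_lift`,
`TrisectionFunctorGKStabilization.lean`; Lyndon–Schupp Ch. I §4 and Prop. II.5.8), via
`TrisectionKernels.Iso.stabilizeIter_of_liftable` and §6.  So leaf (i) is reduced to three
inputs none of which is vendored here: GK Thm. 11 (Cerf theory), the geometric stabilisation for
one marking (in progress upstream, fact (c′)/(d′) seats), and Nielsen's theorem.

## 9. Five leaves: (g′) fed by `exists_marking_centralSurface_of_gkTrisection_holds`

`Literature.Topology.FourManifolds.spc4_iff_forall_isStablyTrivial_of_five_leaves`: the assembly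
of §4 with hypothesis (g′) — the central surface `F = X₁ ∩ X₂ ∩ X₃` of a balanced `(g, k)`
Gay–Kirby trisection is marked by the surface group, `π₁(F, x₀) ≅ S_g` (GK Def. 1: `F` is a closed
orientable surface of genus `g`; Hatcher §1.2) — discharged by
`exists_marking_centralSurface_of_gkTrisection_holds` (`FlowerMelon.lean`: the flower handlebody
model of the `1`-handlebody, its boundary cut into `g` slices, van Kampen).  FIVE named leaves
remain before `spc4_iff_forall_isStablyTrivial_holds`: Gay–Kirby Thm. 4
(`exists_isBalancedGKTrisection`), (b′) `diffeomorph_of_iso_groupGKTrisectionOf`,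
(c′) `exists_stabilized_gkTrisection`, (e′) `exists_gkTrisected_of_isGroupTrisection`,
(i) `stablyIso_groupGKTrisectionOf_of_diffeomorphic`.

## 10. The two directions of Cor. 6 separately, each from three leaves

The equivalence splits unevenly over the five remaining leaves.
`Literature.Topology.FourManifolds.spc4_of_forall_isStablyTrivial_of_three_leaves`: the direction
*"every `(3k, k)`-trisection of the trivial group is stably trivial ⇒ SPC4"* — the one the summit
route consumes (`spc4_of_forall_isStablyTrivial`) — needs only Gay–Kirby Thm. 4 (`hGK`), (b′)
rigidity (`hb`) and (c′) stabilisation (`hc`); it does not involve (e′) (the map `ℳ`: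
Laudenbach–Poénaru, Waldhausen, geometrisation) nor (i) (GK Thm. 11, Cerf theory).
`Literature.Topology.FourManifolds.forall_isStablyTrivial_of_spc4_of_three_leaves`: the converse
*"SPC4 ⇒ every `(3k, k)`-trisection of the trivial group is stably trivial"* needs only (c′) (for
the standard trisections of `S⁴`, (d′)), (e′) and (i).  Both at every universe, on both sides
(`spc4_univ_of_univ`, `forall_isStablyTrivial_univ_of_univ`), with (a′), (g′), (h), GK Remark 2
and `spc4.S10` fed by their proved discharges as in §§3, 4, 9.

## 11. The deciding direction from ONE stabilisable marking per trisection (no Nielsen)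

In the printed proof the markings of central surfaces are parametrisations by the model surface,
and AGK's compatibility of `𝒢` with stabilisation is a statement about those geometric markings;
the tree's (c′) quantifies over ALL abstract markings `S_g ≃* π₁(F, x₀)`, which costs Nielsen's
lifting theorem on top of the geometric construction (header of
`TrisectionFunctorGKStabilization.lean`).  For the direction RHS ⇒ SPC4 the marking of the
trisected homotopy sphere is OURS to choose, so all that direction needs from the stabilisation
theory is hypothesis (G): *every balanced Gay–Kirby trisection of a closed connected oriented
smooth 4-manifold has SOME based marking `(x₀, μ)` and, for every `n`, a balanced
`(g + 3n, k + n)`-trisection with a based marking whose kernel triple EQUALS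
`(𝒢(S, x₀, μ)).stabilizeIter n`*.
`Literature.Topology.FourManifolds.spc4_of_forall_isStablyTrivial_of_stabilizableMarking`:
RHS ⇒ SPC4 from Gay–Kirby Thm. 4, (b′), (d′) and (G), at every universe.  (G) follows from (c′)
(`stabilizableMarking_of_stabilization`, with (g′) proved), and — the intended geometric source —
from any class `P` of based markings that every balanced trisection admits and that is carried,
with equality of kernel triples, through ONE geometric stabilisation
(`stabilizableMarking_of_oneStep`; the on-the-nose `π₁` computation of
`TrisectionFunctorGKStabilizationPi1.lean` has this shape for its `θ`-markings).

## 12. Cor. 6 from a Nielsen-free leaf set: a marking class `P` and a stabilisation relation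

The same idea carried through BOTH directions.  In the (⇒) direction the marking of the trisected
manifold realising a group trisection `K` is forced by (e′); in print it is the parametrisation of
the model surface built into `ℳ` (proof of Thm. 5, p. 1542), i.e. a *geometric* marking, for which
"connected sums of group trisections map to connected sums of 4-manifold trisections" holds on the
nose — so neither (c′) for all markings nor the algebraic invariance of stabilisation under
isomorphism (Nielsen) is ever needed, provided (e′) REMEMBERS that its marking is geometric.
`Literature.Topology.FourManifolds.spc4_iff_forall_isStablyTrivial_of_markingClass`: the named
fact (f), at every universe, from Gay–Kirby Thm. 4, (b′), and — for an arbitrary class `P` of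
based markings and an arbitrary relation `Stab` — (`hP₀`) existence of `P`-markings, (`hSt`)
existence of `Stab`-stabilisations, (`hStabP`) AGK's compatibility on the nose for `P`-markings,
(`hStab_map`) transport of `Stab` along diffeomorphisms, (`hGK11`) Gay–Kirby's Thm. 11 ON `S⁴`
ONLY, (`hdP`) the standard `P`-marked `(3, 1)`-trisection of `S⁴`, and (`heP`) the map `ℳ` with
its `P`-marking.  The (⇒) direction alone
(`forall_isStablyTrivial_of_spc4_of_markingClass`) uses `hStabP`, `hStab_map`, `hGK11`, `hdP`,
`heP`: realise `K` by `heP`, identify the manifold with `S⁴` (SPC4 via (a′), (h), `spc4.S10`, all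
proved), stabilise there until Gay–Kirby's diffeomorphism `ψ` of `S⁴` matches it with a stabilised
standard trisection, and compare two based markings of that one trisection (§6).  Intended
instances: `P` = the datum (`θ`-) markings of `TrisectionStabilizationDatum.lean`, `Stab` =
iterated Gay–Kirby stabilisation; then `hStabP` is the iterated shape of
`exists_marking_groupGKTrisectionOf_eq_stabilize_datum`, and `heP` is (e′) as constructed in print.

No definition is introduced; nothing is asserted; no statement of `TrisectionFunctorSPC4.lean` is
modified.

## References

* [AbramsGayKirby2018] A. Abrams, D. Gay, R. Kirby, *Group trisections and smooth 4-manifolds*,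
  Geom. Topol. 22 (2018) 1537–1545 (arXiv:1605.06731): Cor. 6 and its proof (p. 1541); the map `𝒢`
  (p. 1540), Def. 3 (p. 1540), Thm. 5 (p. 1541) and its proof (p. 1542).
* [GayKirby2016] D. Gay, R. Kirby, *Trisecting 4-manifolds*, Geom. Topol. 20 (2016) 3097–3132
  (arXiv:1205.1565): Def. 1 and Remark 2 (p. 3098); Def. 8 (stabilisation, p. 3099) and Thm. 11
  (uniqueness up to stabilisation, p. 3101; arXiv p. 4).
* [LyndonSchupp2001] R. C. Lyndon, P. E. Schupp, *Combinatorial Group Theory*, Springer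
  (1977/2001): Ch. I §4, last remark (Nielsen's lifting theorem) and Prop. II.5.8 (Magnus) — only
  as the source of hypothesis `hN` of §8.
* [MeierSchirmerZupan2016] J. Meier, T. Schirmer, A. Zupan, *Classification of trisections and
  the generalized property R conjecture*, Proc. AMS 144 (2016) 4983–4997: Remark 3.12.
* [HatcherAT2002] A. Hatcher, *Algebraic Topology*, CUP 2002: Prop. 2.7, Thm. 2A.1, §3.1 Thm. 3.2
  and Cor. 3.3, Prop. 3.25, Thm. 3.26, Thm. 3.30, App. A Cor. A.8–A.9.
* [Spanier1981] E. H. Spanier, *Algebraic Topology* (1966), Ch. 6 §1 Thm. 10 (tautness),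
  Ch. 4 §3 Thm. 14 (Euler characteristic along exact sequences).
-/

noncomputable section

open scoped Manifold ContDiff ContinuousMap
open Set Function CategoryTheory Limits
open _root_.Topology
open Literature.AlgebraicTopology.SingularHomology Literature.AlgebraicTopology.Homotopy

namespace Literature.Topology.FourManifolds

universe u

/-! ### 1. The Euler characteristic of a trisected closed 4-manifold (Gay–Kirby, Remark 2) -/

/-- **The integral homology of a closed topological 4-manifold is finitely generated and vanishes
from degree `5` on** (Hatcher 2002, App. A Cor. A.8–A.9 and Thm. 3.26(c); the tree's PROVED
`finite_singularHomology_of_compactSpace_holds` and `isZero_singularHomology_of_lt_holds`), in the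
packaging `FinRelHomology ℤ ℤ X ∅ 5` under which `χ(X) = Σ_{j<5} (−1)ʲ rank H_j(X; ℤ)`.
[cite: HatcherAT2002, App. A Cor. A.8–A.9 and Thm. 3.26(c)] -/
theorem finRelHomology_of_compactSpace_four (X : Type u) [TopologicalSpace X] [T2Space X]
    [CompactSpace X] [ChartedSpace (EuclideanSpace ℝ (Fin 4)) X] :
    FinRelHomology ℤ ℤ X ∅ 5 :=
  FinRelHomology.empty_of_absolute
    (fun j => finite_singularHomology_of_compactSpace_holds ℤ X 4 j)
    (fun _ hj => isZero_singularHomology_of_lt_holds ℤ ℤ X 4 (by omega))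

/-- **Gay–Kirby 2016, Remark 2 (unbalanced form: Meier–Schirmer–Zupan 2016, Remark 3.12),
PROVED: `χ(X) = 2 + g − (k₀ + k₁ + k₂)` for a `(g; k₀, k₁, k₂)`-trisected closed 4-manifold.**
Let `X : Type u` be a compact Hausdorff second-countable smooth 4-manifold with a trisection
`S : Fin 3 → Set X` in the sense of `IsGKTrisection X g k S` (sectors with corners along the
central surface).  Then `H_•(X; ℤ)` is finitely generated, zero from degree `5` on, and its Euler
characteristic `relEuler ℤ ℤ X ∅ = Σ_{j<5} (−1)ʲ rank H_j(X; ℤ)` equals `2 + g − (k 0 + k 1 + k 2)`.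
Print (GK Remark 2): "the triple intersection `X₁ ∩ X₂ ∩ X₃` is a surface of genus `g` and
`χ(X) = 2 + g − 3k`."  Proof: inclusion–exclusion of the rational Čech Euler characteristic over
the closed cover by the three sectors (`Cech.euler_union₃`), tautness of the compact pieces
(`finCech_and_euler_of_homeomorph`, Spanier Thm. 6.1.10), the Morse equalities
`χ(X_i) = 1 − kᵢ`, `χ(H_{ij}) = 1 − g`, `χ(F) = 2 − 2g` (`relEuler_of_handleCount`,
`relEuler_boundary_of_handleCount`) and `χ̌(X; ℚ) = χ(X; ℤ)`
(`finRelHomology_of_compactSpace_four`): `χ(X) = Σᵢ (1 − kᵢ) − 3(1 − g) + (2 − 2g)`.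
[cite: GayKirby2016, Remark 2 (p. 3098)] [cite: MeierSchirmerZupan2016, Remark 3.12] -/
theorem relEuler_of_gkTrisection {X : Type u} [TopologicalSpace X] [T2Space X]
    [SecondCountableTopology X] [ChartedSpace (EuclideanSpace ℝ (Fin 4)) X] [IsManifold (𝓡 4) ∞ X]
    [CompactSpace X] {g : ℕ} {k : Fin 3 → ℕ} {S : Fin 3 → Set X} (hT : IsGKTrisection X g k S) :
    FinRelHomology ℤ ℤ X ∅ 5 ∧
      relEuler ℤ ℤ X ∅ = 2 + (g : ℤ) - ((k 0 : ℤ) + k 1 + k 2) := by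
  -- the rational coefficient object
  let Qu : ModuleCat.{u} ℚ := ModuleCat.of ℚ (ULift.{u} ℚ)
  -- `X` embeds in some `ℝᵐ` as a neighbourhood retract (compact manifolds are ENRs)
  obtain ⟨m, ι, hιc⟩ :=
    Literature.Geometry.Manifold.exists_isClosedEmbedding_pi_of_compactSpace
      (EuclideanSpace ℝ (Fin 4)) (M := X)
  have hι : IsEmbedding ι := hιc.isEmbedding
  have hX : IsNeighbourhoodRetract (range ι) :=
    isNeighbourhoodRetract_range_of_compactSpace isNeighbourhoodRetract_of_locallyContractibleSpace_holds
      (EuclideanSpace ℝ (Fin 4)) hι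
  obtain ⟨hcov, hsec, hpair⟩ := hT
  have hKc : ∀ i, IsCompact (S i) := fun i =>
    IsGKTrisection.isCompact (X := X) ⟨hcov, hsec, hpair⟩ i
  -- (a) the sectors: `χ̌(S i) = χ(W_i) = 1 - k i`
  have hSec : ∀ i, Cech.FinCech ℚ Qu (S i) 5 ∧ Cech.euler ℚ Qu (S i) = 1 - (k i : ℤ) := by
    intro i
    obtain ⟨W, _, _, f, hM, hW, -, hh, hf, hrange, -⟩ := hsec i
    haveI := hM; haveI := hW
    haveI : T2Space W := hf.t2Space
    haveI : SecondCountableTopology W := hf.secondCountableTopology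
    let φ : ↥(S i) ≃ₜ W := (hf.toHomeomorph.trans (Homeomorph.setCongr hrange)).symm
    obtain ⟨hP, hPe⟩ := relEuler_of_handleCount hh
    obtain ⟨hF, hFe⟩ := finCech_and_euler_of_homeomorph hι hX (hKc i) φ
      (locallyContractibleSpace_of_chartedSpace_halfSpace 4 W) hP
    exact ⟨hF, hFe.trans hPe⟩
  -- (b) the double intersections and (c) the central surface
  have hPair : ∀ i j, i ≠ j →
      (Cech.FinCech ℚ Qu (S i ∩ S j) 5 ∧ Cech.euler ℚ Qu (S i ∩ S j) = 1 - (g : ℤ)) ∧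
      (Cech.FinCech ℚ Qu (⋂ l, S l) 5 ∧ Cech.euler ℚ Qu (⋂ l, S l) = 2 - 2 * (g : ℤ)) := by
    intro i j hij
    obtain ⟨H, _, _, h, hM, hH, -, hh, hf, hrange, hbd⟩ := hpair i j hij
    haveI := hM; haveI := hH
    haveI : T2Space H := hf.isEmbedding.t2Space
    haveI : SecondCountableTopology H := hf.isEmbedding.secondCountableTopology
    have hKij : IsCompact (S i ∩ S j) := (hKc i).inter_right (hKc j).isClosed
    have hKI : IsCompact (⋂ l, S l) :=
      IsGKTrisection.isCompact_iInter (X := X) ⟨hcov, hsec, hpair⟩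
    constructor
    · let φ : ↥(S i ∩ S j) ≃ₜ H :=
        (hf.isEmbedding.toHomeomorph.trans (Homeomorph.setCongr hrange)).symm
      obtain ⟨hP, hPe⟩ := relEuler_of_handleCount hh
      obtain ⟨hF, hFe⟩ := finCech_and_euler_of_homeomorph hι hX hKij φ
        (locallyContractibleSpace_of_chartedSpace_halfSpace 3 H) (hP.mono (show 2 + 2 ≤ 5 by norm_num))
      exact ⟨hF, hFe.trans hPe⟩
    · let φ : ↥(⋂ l, S l) ≃ₜ ((𝓡∂ 3).boundary H) :=
        ((hf.isEmbedding.homeomorphImage ((𝓡∂ 3).boundary H)).trans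
          (Homeomorph.setCongr hbd)).symm
      obtain ⟨hP, hPe⟩ := relEuler_boundary_of_handleCount hh
      obtain ⟨hF, hFe⟩ := finCech_and_euler_of_homeomorph hι hX hKI φ
        (locallyContractibleSpace_of_chartedSpace (EuclideanSpace ℝ (Fin 2))
          (M := (𝓡∂ 3).boundary H)) (hP.mono (show 2 + 2 ≤ 5 by norm_num))
      refine ⟨hF, hFe.trans ?_⟩
      rw [hPe]
      ring
  -- (d) `X` itself: `χ̌(X; ℚ) = χ(X; ℤ)` by the finiteness of the homology of a closed manifold
  have hfin : FinRelHomology ℤ ℤ X ∅ 5 := finRelHomology_of_compactSpace_four X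
  have hUniv : Cech.FinCech ℚ Qu (univ : Set X) 5 ∧
      Cech.euler ℚ Qu (univ : Set X) = relEuler ℤ ℤ X ∅ :=
    finCech_and_euler_of_homeomorph hι hX isCompact_univ (Homeomorph.Set.univ X)
      (locallyContractibleSpace_of_chartedSpace (EuclideanSpace ℝ (Fin 4)) (M := X)) hfin
  -- inclusion–exclusion over the cover `X = S 0 ∪ S 1 ∪ S 2`
  have hU : S 0 ∪ S 1 ∪ S 2 = univ := union_eq_univ_of_iUnion_fin_three hcov
  have hI : (⋂ l, S l) = S 0 ∩ S 1 ∩ S 2 := iInter_fin_three S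
  obtain ⟨f₀₁, e₀₁⟩ := (hPair 0 1 (by decide)).1
  obtain ⟨f₀₂, e₀₂⟩ := (hPair 0 2 (by decide)).1
  obtain ⟨f₁₂, e₁₂⟩ := (hPair 1 2 (by decide)).1
  obtain ⟨fI, eI⟩ := (hPair 0 1 (by decide)).2
  rw [hI] at fI eI
  obtain ⟨-, hχ⟩ := Cech.euler_union₃ (hKc 0) (hKc 1) (hKc 2) (hSec 0).1 (hSec 1).1 (hSec 2).1
    f₀₁ f₀₂ f₁₂ fI
  rw [hU, hUniv.2, (hSec 0).2, (hSec 1).2, (hSec 2).2, e₀₁, e₀₂, e₁₂, eI] at hχ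
  refine ⟨hfin, ?_⟩
  rw [hχ]
  ring

/-- **Gay–Kirby 2016, Remark 2, balanced form, PROVED: `χ(X) = 2 + g − 3k` for a `(g, k)`-trisected
closed 4-manifold** (`IsBalancedGKTrisection`; print: "`χ(X) = 2 + g − 3k`. Thus `k` is determined
by `X` and `g`"). [cite: GayKirby2016, Remark 2 (p. 3098)] -/
theorem relEuler_of_isBalancedGKTrisection {X : Type u} [TopologicalSpace X] [T2Space X]
    [SecondCountableTopology X] [ChartedSpace (EuclideanSpace ℝ (Fin 4)) X] [IsManifold (𝓡 4) ∞ X]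
    [CompactSpace X] {g k : ℕ} {S : Fin 3 → Set X} (hT : IsBalancedGKTrisection X g k S) :
    FinRelHomology ℤ ℤ X ∅ 5 ∧ relEuler ℤ ℤ X ∅ = 2 + (g : ℤ) - 3 * (k : ℤ) := by
  obtain ⟨hfin, hχ⟩ := relEuler_of_gkTrisection hT.isGKTrisection
  refine ⟨hfin, ?_⟩
  rw [hχ]
  ring

/-- **Abrams–Gay–Kirby 2018, proof of Cor. 6: a `(3k, k)`-trisected closed 4-manifold has Euler
characteristic `2`** ("The Euler characteristic of a `(g, k)`-trisected 4-manifold is `2 − g + 3k`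
[read `2 + g − 3k`], so in this case we have an Euler characteristic `2` … 4-manifold"), as the
alternating sum of the ranks of `H₀, …, H₄`. [cite: AbramsGayKirby2018, Cor. 6, proof (p. 1541)]
[cite: GayKirby2016, Remark 2] -/
theorem sum_finrank_singularHomology_of_gkTrisection_three_mul {X : Type u} [TopologicalSpace X]
    [T2Space X] [SecondCountableTopology X] [ChartedSpace (EuclideanSpace ℝ (Fin 4)) X]
    [IsManifold (𝓡 4) ∞ X] [CompactSpace X] {k : ℕ} {S : Fin 3 → Set X}
    (hT : IsBalancedGKTrisection X (3 * k) k S) :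
    ∑ j ∈ Finset.range 5, (-1 : ℤ) ^ j * (Module.finrank ℤ (singularHomology ℤ ℤ X j) : ℤ) = 2 := by
  obtain ⟨hfin, hχ⟩ := relEuler_of_isBalancedGKTrisection hT
  rw [← hfin.relEuler_empty_eq_sum, hχ]
  push_cast
  ring

/-! ### 2. The homology of a simply connected closed 4-manifold, and the discharge of (h) -/

section SimplyConnected

variable {X : Type u} [TopologicalSpace X] [T2Space X] [CompactSpace X]
  [ChartedSpace (EuclideanSpace ℝ (Fin 4)) X] [SimplyConnectedSpace X]

omit [CompactSpace X] in
/-- **A simply connected topological 4-manifold `X : Type u` is `ℤ`-orientable** (Hatcher 2002,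
Prop. 3.25), in every universe: the tree's `OrientationCover.nonempty_homologicalOrientation`
(lifting the identity through the orientation cover) fed with generators of `H₄(X | x; ℤ) ≅ ℤ`
from the universe-polymorphic `nonempty_localHomology_iso_holds'` (the tree's
`isOrientableOver_of_simplyConnectedSpace` is the case `X : Type`). [cite: HatcherAT2002, Prop. 3.25] -/
theorem isOrientableOver_int_four_of_simplyConnectedSpace : IsOrientableOver ℤ X 4 := by
  refine OrientationCover.nonempty_homologicalOrientation (R := ℤ) (n := 4)
    (E := EuclideanSpace ℝ (Fin 4)) fun x => ?_
  obtain ⟨i⟩ := nonempty_localHomology_iso_holds' ℤ X (n := 4) x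
  let e : localHomology ℤ ℤ X x 4 ≃ₗ[ℤ] ℤ := i.toLinearEquiv.trans ULift.moduleEquiv
  exact ⟨e.symm 1, e, by simp⟩

omit [T2Space X] [CompactSpace X] [SimplyConnectedSpace X] in
/-- **`rank H₀(X; ℤ) = 1` for a connected manifold** (Hatcher 2002, Prop. 2.7: `H₀ ≅ ℤ` for a
path-connected space; a connected manifold is locally path connected, hence path connected).
[cite: HatcherAT2002, Prop. 2.7] -/
theorem finrank_singularHomology_zero_eq_one_of_connected_four [ConnectedSpace X] :
    Module.finrank ℤ (singularHomology ℤ ℤ X 0) = 1 := by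
  haveI := ChartedSpace.locallyPathConnectedSpace (EuclideanSpace ℝ (Fin 4)) X
  haveI : PathConnectedSpace X := pathConnectedSpace_iff_connectedSpace.mpr inferInstance
  rw [finrank_singularHomology_zero_of_pathConnectedSpace ℤ ℤ, Module.finrank_self]

omit [SimplyConnectedSpace X] in
/-- **`rank H₄(X; ℤ) = 1` for a closed connected `ℤ`-oriented 4-manifold** (Hatcher 2002,
Thm. 3.26(a): `H₄(X; ℤ) ≅ ℤ`, the tree's PROVED `nonempty_singularHomology_top_iso_holds`).
[cite: HatcherAT2002, Thm. 3.26(a)] -/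
theorem finrank_singularHomology_four_eq_one [ConnectedSpace X] (μ : HomologicalOrientation ℤ X 4) :
    Module.finrank ℤ (singularHomology ℤ ℤ X 4) = 1 := by
  obtain ⟨e⟩ := nonempty_singularHomology_top_iso_holds (R := ℤ) (X := X) 4 μ
  rw [e.toLinearEquiv.finrank_eq, finrank_ulift_int]

/-- **`H₃(X; ℤ) = 0` for a closed simply connected 4-manifold** (Hatcher 2002, Thm. 3.30 and
Thm. 3.2: `H₃ ≅ H¹ ≅ Hom(H₁, ℤ) = 0`; Poincaré duality is the tree's PROVED
`poincare_duality`, `H¹ = 0` its `isZero_singularCohomology_one_of_simplyConnectedSpace`).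
[cite: HatcherAT2002, Thm. 3.30 and §3.1 Thm. 3.2] -/
theorem isZero_singularHomology_three_of_simplyConnectedSpace (μ : HomologicalOrientation ℤ X 4) :
    IsZero (singularHomology ℤ ℤ X 3) := by
  let D : singularCohomology ℤ ℤ X 1 ≃ₗ[ℤ] singularHomology ℤ ℤ X 3 :=
    poincareDualityEquiv μ (show 1 + 3 = 4 by norm_num) (poincare_duality μ _)
  haveI := ModuleCat.subsingleton_of_isZero
    (isZero_singularCohomology_one_of_simplyConnectedSpace ℤ (X := X))
  haveI : Subsingleton (singularHomology ℤ ℤ X 3) := D.symm.toEquiv.subsingleton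
  exact ModuleCat.isZero_of_subsingleton _

/-- **`H₂(X; ℤ)` of a closed simply connected 4-manifold is zero as soon as its rank is zero**
(Kirby 1989, Ch. II §1: "If `π₁(M) = 0`, then `H₂(M; Z)` … [is a] free `Z`-module of rank equal
to the second Betti number"; Hatcher 2002, Thm. 3.30 and Cor. 3.3: `H₂ ≅ H²` by Poincaré duality,
PROVED in the tree, and `H²` is torsion-free, `torsion_singularCohomology_two_eq_bot`, and finitely
generated, `finite_singularHomology_of_compactSpace_holds`). [cite: HatcherAT2002, Thm. 3.30 and §3.1 Cor. 3.3]
[cite: Kirby1989, Ch. II §1] -/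
theorem isZero_singularHomology_two_of_finrank_eq_zero (μ : HomologicalOrientation ℤ X 4)
    (h0 : Module.finrank ℤ (singularHomology ℤ ℤ X 2) = 0) :
    IsZero (singularHomology ℤ ℤ X 2) := by
  let D : singularCohomology ℤ ℤ X 2 ≃ₗ[ℤ] singularHomology ℤ ℤ X 2 :=
    poincareDualityEquiv μ (show 2 + 2 = 4 by norm_num) (poincare_duality μ _)
  haveI : Module.Finite ℤ (singularHomology ℤ ℤ X 2) :=
    finite_singularHomology_of_compactSpace_holds ℤ X 4 2
  haveI : Module.Finite ℤ (singularCohomology ℤ ℤ X 2) := Module.Finite.equiv D.symm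
  haveI : Module.IsTorsionFree ℤ (singularCohomology ℤ ℤ X 2) :=
    Submodule.isTorsionFree_iff_torsion_eq_bot.mpr (torsion_singularCohomology_two_eq_bot X)
  have h0' : Module.finrank ℤ (singularCohomology ℤ ℤ X 2) = 0 := by rw [D.finrank_eq, h0]
  haveI : Subsingleton (singularCohomology ℤ ℤ X 2) := Module.finrank_zero_iff.mp h0'
  haveI : Subsingleton (singularHomology ℤ ℤ X 2) := D.symm.toEquiv.subsingleton
  exact ModuleCat.isZero_of_subsingleton _

/-- **An Euler-characteristic-`2` simply connected closed 4-manifold has `H₂(X; ℤ) = 0`** (the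
homological unpacking used in Abrams–Gay–Kirby's proof of Cor. 6, "an Euler characteristic `2`
simply connected 4-manifold, i.e. a homotopy `S⁴`"; Hatcher 2002, Thm. 2A.1, Thm. 3.26, Thm. 3.30,
Thm. 3.2): from `Σ_{j<5} (−1)ʲ rank H_j = 2` and `rank H₀ = rank H₄ = 1`, `H₁ = H₃ = 0` one gets
`rank H₂ = 0`, whence `H₂ = 0`. [cite: AbramsGayKirby2018, Cor. 6, proof (p. 1541)]
[cite: HatcherAT2002, Thm. 3.30] -/
theorem isZero_singularHomology_two_of_sum_finrank_eq_two [ConnectedSpace X]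
    (hχ : ∑ j ∈ Finset.range 5, (-1 : ℤ) ^ j * (Module.finrank ℤ (singularHomology ℤ ℤ X j) : ℤ) = 2) :
    IsZero (singularHomology ℤ ℤ X 2) := by
  obtain ⟨μ⟩ := isOrientableOver_int_four_of_simplyConnectedSpace (X := X)
  have h0 : Module.finrank ℤ (singularHomology ℤ ℤ X 0) = 1 := finrank_singularHomology_zero_eq_one_of_connected_four
  have h1 : Module.finrank ℤ (singularHomology ℤ ℤ X 1) = 0 :=
    finrank_eq_zero_of_isZero (isZero_singularHomology_one_of_simplyConnectedSpace ℤ ℤ (X := X))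
  have h3 : Module.finrank ℤ (singularHomology ℤ ℤ X 3) = 0 :=
    finrank_eq_zero_of_isZero (isZero_singularHomology_three_of_simplyConnectedSpace μ)
  have h4 : Module.finrank ℤ (singularHomology ℤ ℤ X 4) = 1 := finrank_singularHomology_four_eq_one μ
  simp only [Finset.sum_range_succ, Finset.sum_range_zero] at hχ
  rw [h0, h1, h3, h4] at hχ
  have h2 : Module.finrank ℤ (singularHomology ℤ ℤ X 2) = 0 := by
    norm_num at hχ
    omega
  exact isZero_singularHomology_two_of_finrank_eq_zero μ h2

end SimplyConnected

/-- **(h) discharged — Abrams–Gay–Kirby 2018, proof of Cor. 6, with Gay–Kirby 2016, Remark 2: a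
`(3k, k)`-trisected simply connected closed 4-manifold has `H₂(X; ℤ) = 0`.**  The named fact
`isZero_singularHomologyZ_two_of_gkTrisection_three_mul` (`TrisectionFunctorSPC4.lean`) holds in
every universe: `χ(X) = 2 + 3k − 3k = 2` (`sum_finrank_singularHomology_of_gkTrisection_three_mul`,
GK Remark 2 proved above) and an Euler-characteristic-`2` simply connected closed 4-manifold has
`H₂ = 0` (`isZero_singularHomology_two_of_sum_finrank_eq_two`: Hurewicz in degree one, Poincaré
duality, universal coefficients — all PROVED in the tree); `singularHomologyZ X 2` is Mathlib's
`H₂(X; ℤ)`, definitionally the tree's `singularHomology ℤ ℤ X 2`.  The orientation hypothesis of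
the fact is not needed (a simply connected manifold is orientable, Hatcher Prop. 3.25).
[cite: AbramsGayKirby2018, Cor. 6, proof (p. 1541)] [cite: GayKirby2016, Remark 2] -/
theorem isZero_singularHomologyZ_two_of_gkTrisection_three_mul_holds :
    isZero_singularHomologyZ_two_of_gkTrisection_three_mul.{u} := by
  intro X _ _ _ _ _ _ _ _ k S hT hsc
  haveI := hsc
  exact isZero_singularHomology_two_of_sum_finrank_eq_two
    (sum_finrank_singularHomology_of_gkTrisection_three_mul hT)

/-- The proved one-liner of `TrisectionFunctorSPC4.lean`, now unconditional: **a `(3k, k)`-trisected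
simply connected closed oriented 4-manifold `X : Type` is a homotopy `S⁴`** (AGK, proof of Cor. 6:
"an Euler characteristic `2` simply connected 4-manifold, i.e. a homotopy `S⁴`"), from
`isZero_singularHomologyZ_two_of_gkTrisection_three_mul_holds` and the discharged `spc4.S10`
(`nonempty_homotopyEquiv_sphere_four_iff_holds`). [cite: AbramsGayKirby2018, Cor. 6, proof (p. 1541)] -/
theorem nonempty_homotopyEquiv_sphere_of_gkTrisection_three_mul_holds
    {X : Type} [TopologicalSpace X] [T2Space X] [SecondCountableTopology X]
    [ChartedSpace (EuclideanSpace ℝ (Fin 4)) X] [IsManifold (𝓡 4) ∞ X] [CompactSpace X]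
    [ConnectedSpace X] (o : SmoothOrientation (𝓡 4) X) {k : ℕ} {S : Fin 3 → Set X}
    (hT : IsBalancedGKTrisection X (3 * k) k S) [SimplyConnectedSpace X] :
    Nonempty (X ≃ₕ Metric.sphere (0 : EuclideanSpace ℝ (Fin 5)) 1) :=
  nonempty_homotopyEquiv_sphere_of_gkTrisection_three_mul
    isZero_singularHomologyZ_two_of_gkTrisection_three_mul_holds
    nonempty_homotopyEquiv_sphere_four_iff_holds X o k S hT

/-! ### 3. Cor. 6 from the seven remaining leaves -/

/-- **Abrams–Gay–Kirby 2018, Cor. 6 — the named fact (f) `spc4_iff_forall_isStablyTrivial` at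
every universe from the SEVEN remaining named leaves**: Gay–Kirby Thm. 4 (existence of balanced
trisections, `hGK`), the marking fact (g′) (`hg`), the parts (a′) `hа`, (b′) `hb`, (c′) `hc`,
(e′) `he` of AGK Thm. 5, and (i) (`hi`, AGK Thm. 5 with GK Thm. 11); the three other hypotheses
of `spc4_iff_forall_isStablyTrivial_of_facts_univ` are discharged by
`gkTrisection_genus_eq_sum_of_homotopyEquiv_sphere_holds` (GK Remark 2 for homotopy spheres),
`isZero_singularHomologyZ_two_of_gkTrisection_three_mul_holds` (this file) and
`nonempty_homotopyEquiv_sphere_four_iff_holds` (`spc4.S10`). [cite: AbramsGayKirby2018, Cor. 6 (p. 1541)] -/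
theorem spc4_iff_forall_isStablyTrivial_of_leaves
    (hGK : exists_isBalancedGKTrisection.{0})
    (hg : exists_marking_centralSurface_of_gkTrisection.{0})
    (ha : isGroupTrisection_groupGKTrisectionOf.{0})
    (hb : diffeomorph_of_iso_groupGKTrisectionOf.{0})
    (hc : exists_stabilized_gkTrisection.{0})
    (he : exists_gkTrisected_of_isGroupTrisection.{0})
    (hi : stablyIso_groupGKTrisectionOf_of_diffeomorphic.{0}) :
    spc4_iff_forall_isStablyTrivial.{u} :=
  spc4_iff_forall_isStablyTrivial_of_facts_univ hGK
    gkTrisection_genus_eq_sum_of_homotopyEquiv_sphere_holds hg ha hb hc he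
    isZero_singularHomologyZ_two_of_gkTrisection_three_mul_holds
    nonempty_homotopyEquiv_sphere_four_iff_holds hi

/-! ### 4. Cor. 6 from the six remaining leaves ((a′) discharged upstream) -/

/-- **Abrams–Gay–Kirby 2018, Cor. 6 — the named fact (f) `spc4_iff_forall_isStablyTrivial` at
every universe from the SIX remaining named leaves**: as `spc4_iff_forall_isStablyTrivial_of_leaves`,
with (a′) — *"the groups are the fundamental groups of the `Xᵢ`'s and their intersections, after
identification with standard models via the parametrizations, and the maps are those induced by
inclusions"* form a group trisection of `π₁(X)` (AGK p. 1540, the map `𝒢`) — now supplied by the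
PROVED `isGroupTrisection_groupGKTrisectionOf_holds` (`TrisectionFunctorGKVanKampen.lean`).
Remaining hypotheses: Gay–Kirby Thm. 4 (`hGK`), the marking fact (g′) (`hg`), the parts (b′) `hb`,
(c′) `hc`, (e′) `he` of AGK Thm. 5, and (i) `hi` (AGK Thm. 5 with GK Thm. 11).
[cite: AbramsGayKirby2018, Cor. 6 (p. 1541); p. 1540 (the map 𝒢)] -/
theorem spc4_iff_forall_isStablyTrivial_of_six_leaves
    (hGK : exists_isBalancedGKTrisection.{0})
    (hg : exists_marking_centralSurface_of_gkTrisection.{0})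
    (hb : diffeomorph_of_iso_groupGKTrisectionOf.{0})
    (hc : exists_stabilized_gkTrisection.{0})
    (he : exists_gkTrisected_of_isGroupTrisection.{0})
    (hi : stablyIso_groupGKTrisectionOf_of_diffeomorphic.{0}) :
    spc4_iff_forall_isStablyTrivial.{u} :=
  spc4_iff_forall_isStablyTrivial_of_leaves hGK hg isGroupTrisection_groupGKTrisectionOf_holds.{0}
    hb hc he hi

/-! ### 5. Leaf (i) from its single-manifold case -/

/-- **Leaf (i) `stablyIso_groupGKTrisectionOf_of_diffeomorphic` follows from its case `X = X'`**
(Gay–Kirby Thm. 11 in `𝒢`-form: two balanced trisections `S`, `S'` of ONE closed connected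
oriented smooth 4-manifold `X`, of types `(g, k)`, `(g', k')`, with any base points and markings,
have kernel triples which become isomorphic after `n`, `n'` algebraic stabilisations,
`g' + 3n' = g + 3n`).  Abrams–Gay–Kirby, proof of Thm. 5 (p. 1542): *"any two trisections of the
same 4-manifold become isotopic after performing some number of connected sums with the standard
`(3, 1)`-trisection of `S⁴`. … The connected sum operation and the `(3, 1)`-trisection on the
group side are constructed exactly to correspond to stabilization of manifolds via the map `ℳ`."*
Reduction: given a diffeomorphism `φ : X ≅ X'`, the sectors `φ⁻¹(S'ᵢ)` form a balanced
`(g', k')`-trisection of `X` (`IsGKTrisection.image_diffeomorph`: Gay–Kirby's Def. 1 is natural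
under diffeomorphisms) whose kernel triple, for the transported base point `φ⁻¹ x₀'` and marking
`(φ⁻¹|_{F'})_* ∘ μ'`, EQUALS that of `(S', x₀', μ')` (`exists_groupGKTrisectionOf_eq_of_homeomorph`,
AGK p. 1540: `𝒢` is defined up to trisected diffeomorphism); apply the hypothesis in `X`.
The hypothesis `H` is Gay–Kirby's Thm. 11 read through `𝒢` and is NOT proved in the tree (Cerf
theory); this theorem only removes the second manifold from leaf (i).
[cite: AbramsGayKirby2018, Thm. 5 (p. 1541), proof (p. 1542); p. 1540 (the map 𝒢)]
[cite: GayKirby2016, Thm. 11] -/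
theorem stablyIso_groupGKTrisectionOf_of_diffeomorphic_of_sameManifold
    (H : ∀ (X : Type u) [TopologicalSpace X] [T2Space X] [SecondCountableTopology X]
      [ChartedSpace (EuclideanSpace ℝ (Fin 4)) X] [IsManifold (𝓡 4) ∞ X] [CompactSpace X]
      [ConnectedSpace X] (_ : SmoothOrientation (𝓡 4) X)
      (g k g' k' : ℕ) (S S' : Fin 3 → Set X)
      (h : IsBalancedGKTrisection X g k S) (h' : IsBalancedGKTrisection X g' k' S')
      (x₀ : centralSurface S) (x₀' : centralSurface S')
      (μ : SurfaceGroup g ≃* FundamentalGroup (centralSurface S) x₀)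
      (μ' : SurfaceGroup g' ≃* FundamentalGroup (centralSurface S') x₀'),
      ∃ (n n' : ℕ) (e : g' + 3 * n' = g + 3 * n),
        TrisectionKernels.Iso ((groupGKTrisectionOf h x₀ μ).stabilizeIter n)
          (((groupGKTrisectionOf h' x₀' μ').stabilizeIter n').cast e)) :
    stablyIso_groupGKTrisectionOf_of_diffeomorphic.{u} := by
  intro X _ _ _ _ _ _ _ o X' _ _ _ _ _ _ _ _ g k g' k' S S' h h' x₀ x₀' μ μ' hφ
  obtain ⟨φ⟩ := hφ
  -- transport `S'` back to `X` along `φ⁻¹` (Gay–Kirby's Def. 1 is natural under diffeomorphisms)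
  have h'' : IsGKTrisection X g' (fun _ => k') (fun i => φ.symm.toHomeomorph '' S' i) :=
    h'.isGKTrisection.image_diffeomorph φ.symm
  -- the transported base point and marking have the same kernel triple (AGK p. 1540)
  obtain ⟨x₀'', μ'', -, hK⟩ :=
    exists_groupGKTrisectionOf_eq_of_homeomorph h'.isGKTrisection φ.symm.toHomeomorph h'' x₀' μ'
  obtain ⟨n, n', e, hiso⟩ :=
    H X o g k g' k' S (fun i => φ.symm.toHomeomorph '' S' i) h h'' x₀ x₀'' μ μ''
  refine ⟨n, n', e, ?_⟩
  rw [← hK]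
  exact hiso

/-! ### 6. `𝒢` is well defined up to isomorphism of kernel triples -/

section WellDefined

variable {X : Type u} [TopologicalSpace X] [T2Space X] [ChartedSpace (EuclideanSpace ℝ (Fin 4)) X]
  {g : ℕ} {k k' : Fin 3 → ℕ} {S : Fin 3 → Set X}

/-- **Abrams–Gay–Kirby's `𝒢` is well defined up to isomorphism of kernel triples.**  For a
Gay–Kirby trisection `S` of `X`, any two base points `x₀, x₁` of the central surface
`F = ⋂ l, S l` and any two markings `μ₀ : S_g ≃* π₁(F, x₀)`, `μ₁ : S_g ≃* π₁(F, x₁)` give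
isomorphic kernel triples `𝒢(S, x₀, μ₀) ≅ 𝒢(S, x₁, μ₁)` (`TrisectionKernels.Iso`: an automorphism
of `S_g` carrying one triple to the other).  Proof: `F` is path connected
(`IsGKTrisection.isPathConnected_iInter`); transporting `μ₀` along a path `δ ⊂ F` from `x₀` to
`x₁` does not change the kernel triple (`groupGKTrisectionOf_transport`: the change of base point
commutes with the inclusion-induced maps `π₁ F → π₁ Hᵢ`, Hatcher Prop. 1.5), and two markings at
the same base point differ by an automorphism of `S_g` (`groupGKTrisectionOf_iso_of_markings`).
This is the sense in which `𝒢`, defined by Abrams–Gay–Kirby on *based, parametrized* trisected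
4-manifolds (p. 1540: "There is an obvious map from the set of parametrized based trisected
4-manifolds to the set of trisected groups, which we will call `𝒢`"), is a map of trisected
4-manifolds "up to trisected isomorphism" (Thm. 5).  The two proofs `h₀`, `h₁` may carry
different sector data `k`, `k'`: `𝒢` does not depend on them.
[cite: AbramsGayKirby2018, p. 1540 (the map 𝒢) and Thm. 5 (p. 1541)] [cite: HatcherAT2002, Prop. 1.5] -/
theorem groupGKTrisectionOf_iso (h₀ : IsGKTrisection X g k S) (h₁ : IsGKTrisection X g k' S)
    (x₀ x₁ : centralSurface S) (μ₀ : SurfaceGroup g ≃* FundamentalGroup (centralSurface S) x₀)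
    (μ₁ : SurfaceGroup g ≃* FundamentalGroup (centralSurface S) x₁) :
    TrisectionKernels.Iso (groupGKTrisectionOf h₀ x₀ μ₀) (groupGKTrisectionOf h₁ x₁ μ₁) := by
  obtain ⟨x₀, hx₀⟩ := x₀
  obtain ⟨x₁, hx₁⟩ := x₁
  -- a path from `x₀` to `x₁` inside the central surface
  have hJ : JoinedIn (⋂ l, S l) x₀ x₁ := h₀.isPathConnected_iInter.joinedIn x₀ hx₀ x₁ hx₁
  have hδ : ∀ s, hJ.somePath s ∈ ⋂ l, S l := hJ.somePath_mem
  -- transporting `μ₀` along it does not change the kernel triple (Hatcher Prop. 1.5)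
  have hT := groupGKTrisectionOf_transport h₀ hx₀ hx₁ hJ.somePath hδ μ₀
  -- `𝒢` does not depend on the proof of `IsGKTrisection` (nor on the sector data `k'`)
  have hh : groupGKTrisectionOf h₁ ⟨x₁, hx₁⟩ μ₁ = groupGKTrisectionOf h₀ ⟨x₁, hx₁⟩ μ₁ := rfl
  have key := groupGKTrisectionOf_iso_of_markings h₀ ⟨x₁, hx₁⟩
    (μ₀.trans (FundamentalGroup.fundamentalGroupMulEquivOfPath
      (Literature.AlgebraicTopology.FundamentalGroup.VanKampen.liftPath (⋂ l, S l) hJ.somePath hδ)))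
    μ₁
  rw [hT] at key
  rw [hh]
  exact key

/-- Genus bookkeeping for `groupGKTrisectionOf_iso`: the same over an equality of genera
`e : G' = G` (two Gay–Kirby trisection structures of types `(G; κ)`, `(G'; κ')` on the same
sector triple `S`), with the second kernel triple transported along `e` (`TrisectionKernels.cast`).
[cite: AbramsGayKirby2018, p. 1540 (the map 𝒢)] -/
theorem groupGKTrisectionOf_iso_cast {G G' : ℕ} (e : G' = G) {κ κ' : Fin 3 → ℕ}
    (h : IsGKTrisection X G κ S) (h' : IsGKTrisection X G' κ' S)
    (x : centralSurface S) (x' : centralSurface S)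
    (μ : SurfaceGroup G ≃* FundamentalGroup (centralSurface S) x)
    (μ' : SurfaceGroup G' ≃* FundamentalGroup (centralSurface S) x') :
    TrisectionKernels.Iso (groupGKTrisectionOf h x μ) ((groupGKTrisectionOf h' x' μ').cast e) := by
  subst e
  exact groupGKTrisectionOf_iso h h' x x' μ μ'

omit [TopologicalSpace X] [T2Space X] [ChartedSpace (EuclideanSpace ℝ (Fin 4)) X] in
/-- Isomorphism of kernel triples is preserved by transport along an equality of genera.
[folklore] -/
theorem TrisectionKernels.Iso.cast_congr {G G' : ℕ} (e : G' = G) {K K' : TrisectionKernels G'}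
    (hK : K.Iso K') : (K.cast e).Iso (K'.cast e) := by
  subst e
  exact hK

end WellDefined

/-! ### 7. Leaf (i) from Gay–Kirby's Theorem 11 and the `𝒢`-compatibility of stabilisation -/

/-- **Leaf (i) `stablyIso_groupGKTrisectionOf_of_diffeomorphic` from Gay–Kirby's uniqueness
theorem and Abrams–Gay–Kirby's compatibility of `𝒢` with stabilisation — for ANY stabilisation
relation.**  Let `Stab X n S Sₙ` be any relation between sector triples of a smooth 4-manifold `X`
(read: "`Sₙ` is obtained from `S` by `n` stabilisations", Gay–Kirby Def. 8) such that

* (`hStab`, Abrams–Gay–Kirby Thm. 5, p. 1541: *"connected sums of group trisections map to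
  connected sums of 4-manifold trisections"*; proof, p. 1542: *"The connected sum operation and
  the `(3,1)`-trisection on the group side are constructed exactly to correspond to stabilization
  of manifolds via the map `ℳ`"*) if `Sₙ` is an `n`-fold stabilisation of a balanced
  `(g, k)`-trisection `S` of a closed connected oriented `X` and is a balanced
  `(g + 3n, k + n)`-trisection, then for every base point and marking `(x₀, μ)` of `S` some base
  point and marking of `Sₙ` has kernel triple isomorphic to the `n`-fold algebraic stabilisation
  `𝒢(S, x₀, μ).stabilizeIter n`; and
* (`hGK11`, Gay–Kirby Thm. 11, p. 3101: *"Given two trisections of `X`, `(X₁, X₂, X₃)` and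
  `(X₁', X₂', X₃')`, then after stabilizing each trisection some number of times, there is a
  diffeomorphism `h : X → X` isotopic to the identity with the property that `h(Xᵢ) = Xᵢ'` for
  each `i`"*; here without "isotopic to the identity", and with the genus bookkeeping
  `g' + 3n' = g + 3n` of the two stabilised trisections made explicit) any two balanced
  trisections `S`, `S'` of `X` have stabilisations `Sₙ`, `S'ₙ'` (balanced, of types
  `(g + 3n, k + n)`, `(g' + 3n', k' + n')`) with `ψ(Sₙ ᵢ) = S'ₙ' ᵢ` for a diffeomorphism `ψ` of `X`.

Then diffeomorphic trisected closed 4-manifolds have stably isomorphic kernel triples, for all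
base points and markings (leaf (i) of `TrisectionFunctorSPC4.lean`, every universe).  Proof
(Abrams–Gay–Kirby, proof of Thm. 5, last paragraph): by
`stablyIso_groupGKTrisectionOf_of_diffeomorphic_of_sameManifold` one manifold suffices; given
`(S, x₀, μ)`, `(S', x₀', μ')`, take `Sₙ`, `S'ₙ'`, `ψ` from `hGK11` and based markings of `Sₙ`,
`S'ₙ'` from `hStab`; `ψ(Sₙ)` is `S'ₙ'`, and the kernel triple of `(Sₙ, xₙ, μₙ)` pushed forward
along `ψ` is unchanged (`exists_groupGKTrisectionOf_eq_of_homeomorph`, AGK p. 1540), while any two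
based markings of the one trisection `S'ₙ'` give isomorphic kernel triples
(`groupGKTrisectionOf_iso`, §6); compose the isomorphisms.  Neither hypothesis is vendored as a
named fact here: GK Thm. 11 is Cerf theory (Morse 2-functions), and `hStab` for all markings is
the geometric stabilisation for one marking (`TrisectionFunctorGKStabilizationPi1.lean`,
`TrisectionStabilizationDatum.lean`) plus the liftability of automorphisms of `S_g`
(`TrisectionKernels.Iso.stabilize_of_lift`, Nielsen); this theorem is the remaining glue.
[cite: AbramsGayKirby2018, Thm. 5 (p. 1541) and its proof (p. 1542); p. 1540 (the map 𝒢)]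
[cite: GayKirby2016, Def. 8 (p. 3099) and Thm. 11 (p. 3101)] -/
theorem stablyIso_groupGKTrisectionOf_of_diffeomorphic_of_uniqueness
    (Stab : ∀ (X : Type u) [TopologicalSpace X] [ChartedSpace (EuclideanSpace ℝ (Fin 4)) X],
      ℕ → (Fin 3 → Set X) → (Fin 3 → Set X) → Prop)
    (hStab : ∀ (X : Type u) [TopologicalSpace X] [T2Space X] [SecondCountableTopology X]
      [ChartedSpace (EuclideanSpace ℝ (Fin 4)) X] [IsManifold (𝓡 4) ∞ X] [CompactSpace X]
      [ConnectedSpace X] (_ : SmoothOrientation (𝓡 4) X)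
      (g k n : ℕ) (S Sₙ : Fin 3 → Set X)
      (h : IsBalancedGKTrisection X g k S) (hₙ : IsBalancedGKTrisection X (g + 3 * n) (k + n) Sₙ),
      Stab X n S Sₙ →
      ∀ (x₀ : centralSurface S) (μ : SurfaceGroup g ≃* FundamentalGroup (centralSurface S) x₀),
      ∃ (xₙ : centralSurface Sₙ)
        (μₙ : SurfaceGroup (g + 3 * n) ≃* FundamentalGroup (centralSurface Sₙ) xₙ),
        TrisectionKernels.Iso (groupGKTrisectionOf hₙ.isGKTrisection xₙ μₙ)
          ((groupGKTrisectionOf h.isGKTrisection x₀ μ).stabilizeIter n))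
    (hGK11 : ∀ (X : Type u) [TopologicalSpace X] [T2Space X] [SecondCountableTopology X]
      [ChartedSpace (EuclideanSpace ℝ (Fin 4)) X] [IsManifold (𝓡 4) ∞ X] [CompactSpace X]
      [ConnectedSpace X] (_ : SmoothOrientation (𝓡 4) X)
      (g k g' k' : ℕ) (S S' : Fin 3 → Set X),
      IsBalancedGKTrisection X g k S → IsBalancedGKTrisection X g' k' S' →
      ∃ (n n' : ℕ) (_ : g' + 3 * n' = g + 3 * n) (Sₙ S'ₙ : Fin 3 → Set X),
        IsBalancedGKTrisection X (g + 3 * n) (k + n) Sₙ ∧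
        IsBalancedGKTrisection X (g' + 3 * n') (k' + n') S'ₙ ∧
        Stab X n S Sₙ ∧ Stab X n' S' S'ₙ ∧
        ∃ ψ : X ≃ₘ⟮𝓡 4, 𝓡 4⟯ X, ∀ i, ψ '' Sₙ i = S'ₙ i) :
    stablyIso_groupGKTrisectionOf_of_diffeomorphic.{u} := by
  refine stablyIso_groupGKTrisectionOf_of_diffeomorphic_of_sameManifold ?_
  intro X _ _ _ _ _ _ _ o g k g' k' S S' h h' x₀ x₀' μ μ'
  obtain ⟨n, n', e, Sₙ, S'ₙ, hₙ, h'ₙ, hst, hst', ψ, hψ⟩ := hGK11 X o g k g' k' S S' h h'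
  -- based markings of the two stabilised trisections (AGK Thm. 5: `𝒢 ∘ stab = stab ∘ 𝒢`)
  obtain ⟨xₙ, μₙ, iso₁⟩ := hStab X o g k n S Sₙ h hₙ hst x₀ μ
  obtain ⟨x'ₙ, μ'ₙ, iso₂⟩ := hStab X o g' k' n' S' S'ₙ h' h'ₙ hst' x₀' μ'
  -- push `(Sₙ, xₙ, μₙ)` forward along `ψ`: same kernel triple (AGK p. 1540)
  have himg : IsGKTrisection X (g + 3 * n) (fun _ => k + n) (fun i => ψ.toHomeomorph '' Sₙ i) :=
    hₙ.isGKTrisection.image_diffeomorph ψ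
  obtain ⟨x'', μ'', -, hK⟩ :=
    exists_groupGKTrisectionOf_eq_of_homeomorph hₙ.isGKTrisection ψ.toHomeomorph himg xₙ μₙ
  -- `ψ(Sₙ) = S'ₙ'`
  have hSS : (fun i => ψ.toHomeomorph '' Sₙ i) = S'ₙ := funext fun i => hψ i
  subst hSS
  -- compare the two based markings of `S'ₙ'` across the genus bookkeeping `e`
  have iso₃ := groupGKTrisectionOf_iso_cast e himg h'ₙ.isGKTrisection x'' x'ₙ μ'' μ'ₙ
  rw [hK] at iso₃
  exact ⟨n, n', e, (iso₁.symm.trans iso₃).trans (iso₂.cast_congr e)⟩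

/-! ### 8. The same from one marking and Nielsen's lifting theorem -/

/-- **Stabilisation of kernel triples respects isomorphism, granted Nielsen's lifting theorem.**
If every automorphism `α` of every surface group `S_G` is *liftable* — induced by an automorphism
`φ` of the free group on `a₁, b₁, …, a_G, b_G` with `φ(r_G) = c · r_G^{±1} · c⁻¹` for the surface
relator `r_G = ∏ [aᵢ, bᵢ]` (the hypothesis of `TrisectionKernels.Iso.stabilize_of_lift`; that
every `α` is liftable is Nielsen's theorem together with Magnus' conjugacy theorem, Lyndon–Schupp,
*Combinatorial Group Theory*, Ch. I §4, last remark, and Prop. II.5.8, as analysed in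
`TrisectionFunctorGKStabilization.lean`; it is a HYPOTHESIS here) — then isomorphic kernel triples
have isomorphic `n`-fold stabilisations (Abrams–Gay–Kirby
Def. 3: stabilisation as an operation on trisections up to isomorphism).  Induction on `n` over
`TrisectionKernels.Iso.stabilize_of_lift` (`TrisectionFunctorGKStabilization.lean`).
[cite: AbramsGayKirby2018, Def. 3 (p. 1540)] -/
theorem TrisectionKernels.Iso.stabilizeIter_of_liftable
    (hN : ∀ (G : ℕ) (α : SurfaceGroup G ≃* SurfaceGroup G),
      ∃ (φ : FreeGroup (surfaceGen G) ≃* FreeGroup (surfaceGen G)) (c : FreeGroup (surfaceGen G))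
        (ε : ℤ), (ε = 1 ∨ ε = -1) ∧ φ (surfaceRelator G) = c * surfaceRelator G ^ ε * c⁻¹ ∧
        ∀ x, PresentedGroup.mk _ (φ x) = α (PresentedGroup.mk _ x))
    {g : ℕ} {K K' : TrisectionKernels g} (hK : K.Iso K') (n : ℕ) :
    (K.stabilizeIter n).Iso (K'.stabilizeIter n) := by
  induction n with
  | zero => exact hK
  | succ n ih =>
    obtain ⟨α, hα⟩ := ih
    exact TrisectionKernels.Iso.stabilize_of_lift ⟨α, hN _ α, hα⟩

/-- **The `𝒢`-compatibility of stabilisation for ALL based markings from ONE, granted Nielsen.**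
If (`hStab₁`) every `n`-fold stabilisation `Sₙ` (in the sense of an arbitrary relation `Stab`)
of a balanced trisection `S` of a closed connected oriented smooth 4-manifold carries, for SOME
base point and marking `(x₀, μ₀)` of `S`, a base point and marking `(xₙ, μₙ)` whose kernel triple
is *equal* to `𝒢(S, x₀, μ₀).stabilizeIter n` (the shape of the geometric computation
`exists_marking_groupGKTrisectionOf_eq_stabilize_datum`, `TrisectionStabilizationDatum.lean`,
iterated), and (`hN`) every automorphism of every `S_G` is liftable (Nielsen), then the hypothesis
`hStab` of `stablyIso_groupGKTrisectionOf_of_diffeomorphic_of_uniqueness` holds: for EVERY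
`(x₀', μ)` some based marking of `Sₙ` has kernel triple isomorphic to `𝒢(S, x₀', μ).stabilizeIter n`
— since `𝒢(S, x₀', μ) ≅ 𝒢(S, x₀, μ₀)` (`groupGKTrisectionOf_iso`, §6) and stabilisation respects
isomorphism under `hN` (`TrisectionKernels.Iso.stabilizeIter_of_liftable`).
[cite: AbramsGayKirby2018, Thm. 5 (p. 1541), Def. 3 (p. 1540), p. 1540 (the map 𝒢)] -/
theorem groupGKTrisectionOf_stabilizeIter_iso_of_oneMarking
    (Stab : ∀ (X : Type u) [TopologicalSpace X] [ChartedSpace (EuclideanSpace ℝ (Fin 4)) X],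
      ℕ → (Fin 3 → Set X) → (Fin 3 → Set X) → Prop)
    (hN : ∀ (G : ℕ) (α : SurfaceGroup G ≃* SurfaceGroup G),
      ∃ (φ : FreeGroup (surfaceGen G) ≃* FreeGroup (surfaceGen G)) (c : FreeGroup (surfaceGen G))
        (ε : ℤ), (ε = 1 ∨ ε = -1) ∧ φ (surfaceRelator G) = c * surfaceRelator G ^ ε * c⁻¹ ∧
        ∀ x, PresentedGroup.mk _ (φ x) = α (PresentedGroup.mk _ x))
    (hStab₁ : ∀ (X : Type u) [TopologicalSpace X] [T2Space X] [SecondCountableTopology X]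
      [ChartedSpace (EuclideanSpace ℝ (Fin 4)) X] [IsManifold (𝓡 4) ∞ X] [CompactSpace X]
      [ConnectedSpace X] (_ : SmoothOrientation (𝓡 4) X)
      (g k n : ℕ) (S Sₙ : Fin 3 → Set X)
      (h : IsBalancedGKTrisection X g k S) (hₙ : IsBalancedGKTrisection X (g + 3 * n) (k + n) Sₙ),
      Stab X n S Sₙ →
      ∃ (x₀ : centralSurface S) (μ₀ : SurfaceGroup g ≃* FundamentalGroup (centralSurface S) x₀)
        (xₙ : centralSurface Sₙ)
        (μₙ : SurfaceGroup (g + 3 * n) ≃* FundamentalGroup (centralSurface Sₙ) xₙ),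
        groupGKTrisectionOf hₙ.isGKTrisection xₙ μₙ =
          (groupGKTrisectionOf h.isGKTrisection x₀ μ₀).stabilizeIter n)
    (X : Type u) [TopologicalSpace X] [T2Space X] [SecondCountableTopology X]
    [ChartedSpace (EuclideanSpace ℝ (Fin 4)) X] [IsManifold (𝓡 4) ∞ X] [CompactSpace X]
    [ConnectedSpace X] (o : SmoothOrientation (𝓡 4) X)
    (g k n : ℕ) (S Sₙ : Fin 3 → Set X)
    (h : IsBalancedGKTrisection X g k S) (hₙ : IsBalancedGKTrisection X (g + 3 * n) (k + n) Sₙ)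
    (hst : Stab X n S Sₙ)
    (x₀' : centralSurface S) (μ : SurfaceGroup g ≃* FundamentalGroup (centralSurface S) x₀') :
    ∃ (xₙ : centralSurface Sₙ)
      (μₙ : SurfaceGroup (g + 3 * n) ≃* FundamentalGroup (centralSurface Sₙ) xₙ),
      TrisectionKernels.Iso (groupGKTrisectionOf hₙ.isGKTrisection xₙ μₙ)
        ((groupGKTrisectionOf h.isGKTrisection x₀' μ).stabilizeIter n) := by
  obtain ⟨x₀, μ₀, xₙ, μₙ, hK⟩ := hStab₁ X o g k n S Sₙ h hₙ hst
  refine ⟨xₙ, μₙ, ?_⟩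
  rw [hK]
  exact (TrisectionKernels.Iso.stabilizeIter_of_liftable hN
    (groupGKTrisectionOf_iso h.isGKTrisection h.isGKTrisection x₀' x₀ μ μ₀) n).symm

/-- **Leaf (i) from Gay–Kirby's Theorem 11, the geometric stabilisation for ONE marking, and
Nielsen's lifting theorem.**  The three remaining obligations of leaf (i)
`stablyIso_groupGKTrisectionOf_of_diffeomorphic` made explicit, for an arbitrary stabilisation
relation `Stab`: (`hStab₁`) each `n`-fold stabilisation realises the `n`-fold algebraic
stabilisation of the kernel triple on the nose for one based marking (Abrams–Gay–Kirby Thm. 5: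
"connected sums of group trisections map to connected sums of 4-manifold trisections");
(`hN`) every automorphism of `S_g` is liftable to the free group (Nielsen); (`hGK11`) Gay–Kirby's
uniqueness theorem (Thm. 11) for `Stab`.  By `groupGKTrisectionOf_stabilizeIter_iso_of_oneMarking`
and `stablyIso_groupGKTrisectionOf_of_diffeomorphic_of_uniqueness`.  None of the three is vendored
as a named fact here.
[cite: AbramsGayKirby2018, Thm. 5 (p. 1541) and its proof (p. 1542)]
[cite: GayKirby2016, Def. 8 (p. 3099) and Thm. 11 (p. 3101)] -/
theorem stablyIso_groupGKTrisectionOf_of_diffeomorphic_of_oneMarking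
    (Stab : ∀ (X : Type u) [TopologicalSpace X] [ChartedSpace (EuclideanSpace ℝ (Fin 4)) X],
      ℕ → (Fin 3 → Set X) → (Fin 3 → Set X) → Prop)
    (hN : ∀ (G : ℕ) (α : SurfaceGroup G ≃* SurfaceGroup G),
      ∃ (φ : FreeGroup (surfaceGen G) ≃* FreeGroup (surfaceGen G)) (c : FreeGroup (surfaceGen G))
        (ε : ℤ), (ε = 1 ∨ ε = -1) ∧ φ (surfaceRelator G) = c * surfaceRelator G ^ ε * c⁻¹ ∧
        ∀ x, PresentedGroup.mk _ (φ x) = α (PresentedGroup.mk _ x))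
    (hStab₁ : ∀ (X : Type u) [TopologicalSpace X] [T2Space X] [SecondCountableTopology X]
      [ChartedSpace (EuclideanSpace ℝ (Fin 4)) X] [IsManifold (𝓡 4) ∞ X] [CompactSpace X]
      [ConnectedSpace X] (_ : SmoothOrientation (𝓡 4) X)
      (g k n : ℕ) (S Sₙ : Fin 3 → Set X)
      (h : IsBalancedGKTrisection X g k S) (hₙ : IsBalancedGKTrisection X (g + 3 * n) (k + n) Sₙ),
      Stab X n S Sₙ →
      ∃ (x₀ : centralSurface S) (μ₀ : SurfaceGroup g ≃* FundamentalGroup (centralSurface S) x₀)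
        (xₙ : centralSurface Sₙ)
        (μₙ : SurfaceGroup (g + 3 * n) ≃* FundamentalGroup (centralSurface Sₙ) xₙ),
        groupGKTrisectionOf hₙ.isGKTrisection xₙ μₙ =
          (groupGKTrisectionOf h.isGKTrisection x₀ μ₀).stabilizeIter n)
    (hGK11 : ∀ (X : Type u) [TopologicalSpace X] [T2Space X] [SecondCountableTopology X]
      [ChartedSpace (EuclideanSpace ℝ (Fin 4)) X] [IsManifold (𝓡 4) ∞ X] [CompactSpace X]
      [ConnectedSpace X] (_ : SmoothOrientation (𝓡 4) X)
      (g k g' k' : ℕ) (S S' : Fin 3 → Set X),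
      IsBalancedGKTrisection X g k S → IsBalancedGKTrisection X g' k' S' →
      ∃ (n n' : ℕ) (_ : g' + 3 * n' = g + 3 * n) (Sₙ S'ₙ : Fin 3 → Set X),
        IsBalancedGKTrisection X (g + 3 * n) (k + n) Sₙ ∧
        IsBalancedGKTrisection X (g' + 3 * n') (k' + n') S'ₙ ∧
        Stab X n S Sₙ ∧ Stab X n' S' S'ₙ ∧
        ∃ ψ : X ≃ₘ⟮𝓡 4, 𝓡 4⟯ X, ∀ i, ψ '' Sₙ i = S'ₙ i) :
    stablyIso_groupGKTrisectionOf_of_diffeomorphic.{u} :=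
  stablyIso_groupGKTrisectionOf_of_diffeomorphic_of_uniqueness Stab
    (groupGKTrisectionOf_stabilizeIter_iso_of_oneMarking Stab hN hStab₁) hGK11

/-! ### 9. Cor. 6 from the five remaining leaves ((g′) discharged upstream) -/

/-- **Abrams–Gay–Kirby 2018, Cor. 6 — the named fact (f) `spc4_iff_forall_isStablyTrivial` at
every universe from the FIVE remaining named leaves**: as
`spc4_iff_forall_isStablyTrivial_of_six_leaves`, with (g′) — the central surface
`X₁ ∩ X₂ ∩ X₃` of a balanced `(g, k)` Gay–Kirby trisection is marked by the surface group `S_g`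
(*"the triple intersection `X₁ ∩ X₂ ∩ X₃` is a surface of genus `g`"*, GK Def. 1 / Remark 2) — now
supplied by the PROVED `exists_marking_centralSurface_of_gkTrisection_holds` (`FlowerMelon.lean`).
Remaining hypotheses: Gay–Kirby Thm. 4 (`hGK`), the parts (b′) `hb`, (c′) `hc`, (e′) `he` of
AGK Thm. 5, and (i) `hi` (AGK Thm. 5 with GK Thm. 11).
[cite: AbramsGayKirby2018, Cor. 6 (p. 1541)] [cite: GayKirby2016, Def. 1 and Remark 2 (p. 3098)] -/
theorem spc4_iff_forall_isStablyTrivial_of_five_leaves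
    (hGK : exists_isBalancedGKTrisection.{0})
    (hb : diffeomorph_of_iso_groupGKTrisectionOf.{0})
    (hc : exists_stabilized_gkTrisection.{0})
    (he : exists_gkTrisected_of_isGroupTrisection.{0})
    (hi : stablyIso_groupGKTrisectionOf_of_diffeomorphic.{0}) :
    spc4_iff_forall_isStablyTrivial.{u} :=
  spc4_iff_forall_isStablyTrivial_of_six_leaves hGK
    exists_marking_centralSurface_of_gkTrisection_holds.{0} hb hc he hi

/-! ### 10. The two directions of Cor. 6 separately, each from three leaves -/

section Directions

universe v

/-- **Abrams–Gay–Kirby 2018, Cor. 6, direction "every `(3k, k)`-trisection of the trivial group is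
stably trivial ⇒ SPC4", from THREE named leaves, at every universe.**  The direction of Cor. 6
that decides the smooth 4-dimensional Poincaré conjecture from the group side needs only
Gay–Kirby's existence theorem (`hGK`, GK Thm. 4), the rigidity half (b′) of AGK Thm. 5 (`hb`:
isomorphic group trisections come from diffeomorphic manifolds, `ℳ ∘ 𝒢 = id`) and the
stabilisation compatibility (c′) (`hc`, AGK Thm. 5: "connected sums ↦ connected sums"; it also
supplies the standard trisections of `S⁴`, `sphere_gkTrisections_of_stabilization`); GK Remark 2,
(g′) and (a′) are fed by their proved discharges
(`gkTrisection_genus_eq_sum_of_homotopyEquiv_sphere_holds`,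
`exists_marking_centralSurface_of_gkTrisection_holds`, `isGroupTrisection_groupGKTrisectionOf_holds`).
Printed proof (p. 1541): a homotopy 4-sphere `M` is simply connected with `χ(M) = 2`, so a
`(g, k)`-trisection of `M` (GK Thm. 4) has `g = 3k` and its image under `𝒢` is a
`(3k, k)`-trisection of the trivial group; if that is stably trivial, `M` and `S⁴` carry
trisections with isomorphic group trisections, hence are diffeomorphic (Thm. 5).  The group-side
hypothesis may live in any universe `u` (`forall_isStablyTrivial_univ_of_univ`) and the manifold
in any universe `v` (`spc4_univ_of_univ`). [cite: AbramsGayKirby2018, Cor. 6 (p. 1541); Thm. 5 (p. 1541)] -/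
theorem spc4_of_forall_isStablyTrivial_of_three_leaves
    (hGK : exists_isBalancedGKTrisection.{0})
    (hb : diffeomorph_of_iso_groupGKTrisectionOf.{0})
    (hc : exists_stabilized_gkTrisection.{0})
    (hst : ∀ (k : ℕ) (K : TrisectionKernels (3 * k)),
      IsGroupTrisection (3 * k) k (PUnit : Type u) K → K.IsStablyTrivial)
    (M : Type v) [TopologicalSpace M] [T2Space M] [SecondCountableTopology M] :
    ContinuousMap.HomotopyEquiv.NonemptyDiffeomorphSphere M 4 :=
  spc4_univ_of_univ
    (spc4_of_forall_isStablyTrivial_of_facts hGK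
      gkTrisection_genus_eq_sum_of_homotopyEquiv_sphere_holds
      exists_marking_centralSurface_of_gkTrisection_holds.{0}
      isGroupTrisection_groupGKTrisectionOf_holds.{0} hb hc
      (sphere_gkTrisections_of_stabilization hc) (forall_isStablyTrivial_univ_of_univ hst))
    M

/-- **Abrams–Gay–Kirby 2018, Cor. 6, direction "SPC4 ⇒ every `(3k, k)`-trisection of the trivial
group is stably trivial", from THREE named leaves, at every universe.**  This direction needs only
(c′) (`hc`, through the standard `(3, 1)`-trisection of `S⁴`,
`sphere_gkTrisections_of_stabilization`), the surjectivity half (e′) of AGK Thm. 5 (`he`, the map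
`ℳ`: every group trisection is `𝒢` of a trisected closed 4-manifold) and the
injectivity-modulo-stabilisation (i) (`hi`, AGK Thm. 5 with GK Thm. 11); (a′), the homological
content (h) of the printed proof and `spc4.S10` are fed by their proved discharges
(`isGroupTrisection_groupGKTrisectionOf_holds`,
`isZero_singularHomologyZ_two_of_gkTrisection_three_mul_holds`,
`nonempty_homotopyEquiv_sphere_four_iff_holds`).  Printed proof (p. 1541): a `(3k, k)`-trisection
of `{1}` is `𝒢` of a trisected simply connected closed 4-manifold `X` with `χ(X) = 2`, i.e. a
homotopy 4-sphere; under SPC4 `X ≅ S⁴`, whose trisections are stably standard.  SPC4 may be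
assumed in any universe `v` (`spc4_univ_of_univ`) and the trivial group taken in any universe `u`
(`forall_isStablyTrivial_univ_of_univ`). [cite: AbramsGayKirby2018, Cor. 6 (p. 1541); Thm. 5 (p. 1541)]
[cite: GayKirby2016, Thm. 11] -/
theorem forall_isStablyTrivial_of_spc4_of_three_leaves
    (hc : exists_stabilized_gkTrisection.{0})
    (he : exists_gkTrisected_of_isGroupTrisection.{0})
    (hi : stablyIso_groupGKTrisectionOf_of_diffeomorphic.{0})
    (spc4 : ∀ (M : Type v) [TopologicalSpace M] [T2Space M] [SecondCountableTopology M],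
      ContinuousMap.HomotopyEquiv.NonemptyDiffeomorphSphere M 4)
    (k : ℕ) (K : TrisectionKernels (3 * k)) (hK : IsGroupTrisection (3 * k) k (PUnit : Type u) K) :
    K.IsStablyTrivial :=
  forall_isStablyTrivial_univ_of_univ
    (forall_isStablyTrivial_of_spc4_of_facts he isGroupTrisection_groupGKTrisectionOf_holds.{0}
      isZero_singularHomologyZ_two_of_gkTrisection_three_mul_holds
      nonempty_homotopyEquiv_sphere_four_iff_holds hi (sphere_gkTrisections_of_stabilization hc)
      (spc4_univ_of_univ spc4))
    k K hK

/-- **The five-leaf assembly, re-obtained from the two three-leaf directions** (consistency check of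
§10 with §9: the leaf sets `{GK Thm. 4, (b′), (c′)}` and `{(c′), (e′), (i)}` cover the five
remaining leaves, sharing (c′)). [cite: AbramsGayKirby2018, Cor. 6 (p. 1541)] -/
theorem spc4_iff_forall_isStablyTrivial_of_directions
    (hGK : exists_isBalancedGKTrisection.{0})
    (hb : diffeomorph_of_iso_groupGKTrisectionOf.{0})
    (hc : exists_stabilized_gkTrisection.{0})
    (he : exists_gkTrisected_of_isGroupTrisection.{0})
    (hi : stablyIso_groupGKTrisectionOf_of_diffeomorphic.{0}) :
    spc4_iff_forall_isStablyTrivial.{u} :=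
  ⟨fun spc4 k K hK => forall_isStablyTrivial_of_spc4_of_three_leaves hc he hi spc4 k K hK,
    fun hst M _ _ _ => spc4_of_forall_isStablyTrivial_of_three_leaves hGK hb hc hst M⟩

end Directions

/-! ### 11. The deciding direction from one stabilisable marking per trisection -/

section StabilizableMarking

universe v

/-- **(G) from (c′).**  GIVEN the stabilisation fact (c′) `exists_stabilized_gkTrisection` (for all
markings, up to isomorphism), every balanced Gay–Kirby trisection of a closed connected oriented
smooth 4-manifold has a based marking — any marking of the central surface, which exists by the
PROVED (g′) `exists_marking_centralSurface_of_gkTrisection_holds` — whose kernel triple is realised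
ON THE NOSE after every number `n` of stabilisations by a balanced `(g + 3n, k + n)`-trisection with
a based marking (`exists_gkTrisection_stabilizeIter`: re-marking absorbs the isomorphism at each
step).  So hypothesis (G) of `spc4_of_forall_isStablyTrivial_of_stabilizableMarking` is implied by
the leaf (c′). [cite: AbramsGayKirby2018, Def. 3 (p. 1540) and Thm. 5 (p. 1541)] -/
theorem stabilizableMarking_of_stabilization (hc : exists_stabilized_gkTrisection.{u})
    (X : Type u) [TopologicalSpace X] [T2Space X] [SecondCountableTopology X]
    [ChartedSpace (EuclideanSpace ℝ (Fin 4)) X] [IsManifold (𝓡 4) ∞ X] [CompactSpace X]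
    [ConnectedSpace X] (o : SmoothOrientation (𝓡 4) X) (g k : ℕ) (S : Fin 3 → Set X)
    (h : IsBalancedGKTrisection X g k S) :
    ∃ (x₀ : centralSurface S) (μ : SurfaceGroup g ≃* FundamentalGroup (centralSurface S) x₀),
      ∀ n : ℕ, ∃ (S' : Fin 3 → Set X) (h' : IsBalancedGKTrisection X (g + 3 * n) (k + n) S')
        (x₀' : centralSurface S')
        (μ' : SurfaceGroup (g + 3 * n) ≃* FundamentalGroup (centralSurface S') x₀'),
        groupGKTrisectionOf h' x₀' μ' = (groupGKTrisectionOf h x₀ μ).stabilizeIter n := by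
  obtain ⟨x₀, ⟨μ⟩⟩ := exists_marking_centralSurface_of_gkTrisection_holds X o g k S h
  exact ⟨x₀, μ, fun n => exists_gkTrisection_stabilizeIter hc X o h x₀ μ n⟩

/-- **(G) from one geometric stabilisation step for a stabilisation-closed class of markings.**
Let `P` be any class of based markings of balanced Gay–Kirby trisections (intended: the geometric
markings, read through a free basis of `π₁` of the central surface minus a disc, as in
`TrisectionFunctorGKStabilizationPi1.lean`) such that (`hP₀`) every balanced trisection of a closed
connected oriented smooth 4-manifold admits a based marking in `P`, and (`hP₁`) a based marking in
`P` of a `(g, k)`-trisection is carried to a based marking in `P` of some balanced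
`(g + 3, k + 1)`-trisection whose kernel triple EQUALS the algebraic stabilisation (AGK Thm. 5:
"connected sums of group trisections map to connected sums of 4-manifold trisections", computed on
the nose for such markings; GK Def. 8 / Lemma 10).  Then (G): every balanced trisection has a based
marking compatible on the nose with `n`-fold stabilisation for every `n` (induction on `n` inside
the class `P`).  No lifting of automorphisms of `S_g` (Nielsen) is involved.
[cite: AbramsGayKirby2018, Def. 3 (p. 1540), Thm. 5 (p. 1541) and its proof (p. 1542)]
[cite: GayKirby2016, Def. 8 and Lemma 10] -/
theorem stabilizableMarking_of_oneStep
    (P : ∀ (X : Type u) [TopologicalSpace X] [ChartedSpace (EuclideanSpace ℝ (Fin 4)) X]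
      (g k : ℕ) (S : Fin 3 → Set X), IsBalancedGKTrisection X g k S → ∀ x₀ : centralSurface S,
      (SurfaceGroup g ≃* FundamentalGroup (centralSurface S) x₀) → Prop)
    (hP₀ : ∀ (X : Type u) [TopologicalSpace X] [T2Space X] [SecondCountableTopology X]
      [ChartedSpace (EuclideanSpace ℝ (Fin 4)) X] [IsManifold (𝓡 4) ∞ X] [CompactSpace X]
      [ConnectedSpace X] (_ : SmoothOrientation (𝓡 4) X) (g k : ℕ) (S : Fin 3 → Set X)
      (h : IsBalancedGKTrisection X g k S),
      ∃ (x₀ : centralSurface S) (μ : SurfaceGroup g ≃* FundamentalGroup (centralSurface S) x₀),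
        P X g k S h x₀ μ)
    (hP₁ : ∀ (X : Type u) [TopologicalSpace X] [T2Space X] [SecondCountableTopology X]
      [ChartedSpace (EuclideanSpace ℝ (Fin 4)) X] [IsManifold (𝓡 4) ∞ X] [CompactSpace X]
      [ConnectedSpace X] (_ : SmoothOrientation (𝓡 4) X) (g k : ℕ) (S : Fin 3 → Set X)
      (h : IsBalancedGKTrisection X g k S) (x₀ : centralSurface S)
      (μ : SurfaceGroup g ≃* FundamentalGroup (centralSurface S) x₀), P X g k S h x₀ μ →
      ∃ (S' : Fin 3 → Set X) (h' : IsBalancedGKTrisection X (g + 3) (k + 1) S')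
        (x₀' : centralSurface S')
        (μ' : SurfaceGroup (g + 3) ≃* FundamentalGroup (centralSurface S') x₀'),
        P X (g + 3) (k + 1) S' h' x₀' μ' ∧
          groupGKTrisectionOf h' x₀' μ' = (groupGKTrisectionOf h x₀ μ).stabilize)
    (X : Type u) [TopologicalSpace X] [T2Space X] [SecondCountableTopology X]
    [ChartedSpace (EuclideanSpace ℝ (Fin 4)) X] [IsManifold (𝓡 4) ∞ X] [CompactSpace X]
    [ConnectedSpace X] (o : SmoothOrientation (𝓡 4) X) (g k : ℕ) (S : Fin 3 → Set X)
    (h : IsBalancedGKTrisection X g k S) :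
    ∃ (x₀ : centralSurface S) (μ : SurfaceGroup g ≃* FundamentalGroup (centralSurface S) x₀),
      ∀ n : ℕ, ∃ (S' : Fin 3 → Set X) (h' : IsBalancedGKTrisection X (g + 3 * n) (k + n) S')
        (x₀' : centralSurface S')
        (μ' : SurfaceGroup (g + 3 * n) ≃* FundamentalGroup (centralSurface S') x₀'),
        groupGKTrisectionOf h' x₀' μ' = (groupGKTrisectionOf h x₀ μ).stabilizeIter n := by
  obtain ⟨x₀, μ, hμ⟩ := hP₀ X o g k S h
  refine ⟨x₀, μ, fun n => ?_⟩
  suffices H : ∃ (S' : Fin 3 → Set X) (h' : IsBalancedGKTrisection X (g + 3 * n) (k + n) S')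
      (x₀' : centralSurface S')
      (μ' : SurfaceGroup (g + 3 * n) ≃* FundamentalGroup (centralSurface S') x₀'),
      P X (g + 3 * n) (k + n) S' h' x₀' μ' ∧
        groupGKTrisectionOf h' x₀' μ' = (groupGKTrisectionOf h x₀ μ).stabilizeIter n by
    obtain ⟨S', h', x₀', μ', -, hEq⟩ := H
    exact ⟨S', h', x₀', μ', hEq⟩
  induction n with
  | zero => exact ⟨S, h, x₀, μ, hμ, rfl⟩
  | succ n ih =>
    obtain ⟨Sₙ, hₙ, xₙ, μₙ, hPₙ, hK⟩ := ih
    obtain ⟨S', h', x', μ', hP', hEq⟩ := hP₁ X o (g + 3 * n) (k + n) Sₙ hₙ xₙ μₙ hPₙ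
    refine ⟨S', h', x', μ', hP', ?_⟩
    rw [hEq, hK]
    rfl

/-- **Abrams–Gay–Kirby 2018, Cor. 6, direction "every `(3k, k)`-trisection of the trivial group is
stably trivial ⇒ SPC4", from Gay–Kirby Thm. 4 (`hGK`), rigidity (b′) (`hb`), the standard
trisections of `S⁴` (d′) (`hd`) and ONE stabilisable based marking per trisection (`hG`,
hypothesis (G) of the section docstring), at every universe.**  Printed proof (p. 1541) with the
marking chosen from (G): a homotopy 4-sphere `M` is compact, orientable and simply connected; a
balanced `(g, k)`-trisection `S` of `M` (GK Thm. 4) has `g = 3k` (GK Remark 2,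
`gkTrisection_genus_eq_sum_of_homotopyEquiv_sphere_holds`); with the based marking `(x₀, μ)` of
(G), `K = 𝒢(S, x₀, μ)` is a `(3k, k)`-trisection of `π₁ M = 1`
(`isGroupTrisection_groupGKTrisectionOf_holds`), hence stably trivial:
`K.stabilizeIter n ≅ s4Kernels.stabilizeIter m`; (G) realises the left side on the nose by a
trisection of `M`, (d′) the right side by a trisection of `S⁴`, and (b′) turns the isomorphism of
group trisections into a diffeomorphism `M ≅ S⁴`.  Universes: `spc4_univ_of_univ`,
`forall_isStablyTrivial_univ_of_univ`.  With `stabilizableMarking_of_stabilization` and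
`sphere_gkTrisections_of_stabilization` this re-proves
`spc4_of_forall_isStablyTrivial_of_three_leaves`; its point is that (G) asks for one marking, not
all. [cite: AbramsGayKirby2018, Cor. 6 (p. 1541); Thm. 5 (p. 1541)] -/
theorem spc4_of_forall_isStablyTrivial_of_stabilizableMarking
    (hGK : exists_isBalancedGKTrisection.{0})
    (hb : diffeomorph_of_iso_groupGKTrisectionOf.{0})
    (hd : sphere_gkTrisections)
    (hG : ∀ (X : Type) [TopologicalSpace X] [T2Space X] [SecondCountableTopology X]
      [ChartedSpace (EuclideanSpace ℝ (Fin 4)) X] [IsManifold (𝓡 4) ∞ X] [CompactSpace X]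
      [ConnectedSpace X] (_ : SmoothOrientation (𝓡 4) X) (g k : ℕ) (S : Fin 3 → Set X)
      (h : IsBalancedGKTrisection X g k S),
      ∃ (x₀ : centralSurface S) (μ : SurfaceGroup g ≃* FundamentalGroup (centralSurface S) x₀),
        ∀ n : ℕ, ∃ (S' : Fin 3 → Set X) (h' : IsBalancedGKTrisection X (g + 3 * n) (k + n) S')
          (x₀' : centralSurface S')
          (μ' : SurfaceGroup (g + 3 * n) ≃* FundamentalGroup (centralSurface S') x₀'),
          groupGKTrisectionOf h' x₀' μ' = (groupGKTrisectionOf h x₀ μ).stabilizeIter n)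
    (hst : ∀ (k : ℕ) (K : TrisectionKernels (3 * k)),
      IsGroupTrisection (3 * k) k (PUnit : Type u) K → K.IsStablyTrivial)
    (M : Type v) [TopologicalSpace M] [T2Space M] [SecondCountableTopology M] :
    ContinuousMap.HomotopyEquiv.NonemptyDiffeomorphSphere M 4 := by
  have hst₀ : ∀ (k : ℕ) (K : TrisectionKernels (3 * k)),
      IsGroupTrisection (3 * k) k (PUnit : Type) K → K.IsStablyTrivial :=
    forall_isStablyTrivial_univ_of_univ hst
  have hχ : gkTrisection_genus_eq_sum_of_homotopyEquiv_sphere.{0} :=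
    gkTrisection_genus_eq_sum_of_homotopyEquiv_sphere_holds
  refine spc4_univ_of_univ (fun N _ _ _ => ?_) M
  intro _ _ e
  -- packaging of `N ≃ₕ S⁴` (all proved in the tree)
  haveI : CompactSpace N := compactSpace_of_homotopyEquiv_sphere_four_holds N e
  obtain ⟨o⟩ := isOrientable_of_homotopyEquiv_sphere_four_holds N e
  haveI : SimplyConnectedSpace (Metric.sphere (0 : EuclideanSpace ℝ (Fin 5)) 1) :=
    simplyConnectedSpace_sphere_four_holds
  haveI : SimplyConnectedSpace N := e.simplyConnectedSpace
  obtain ⟨o'⟩ := isOrientable_sphere_holds 4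
  -- trisect `N`; `χ = 2` forces `g = 3k`
  obtain ⟨g, k, S, -, hS⟩ := hGK N o
  obtain rfl : g = 3 * k := hχ.balanced N o hS e
  -- the stabilisable based marking of (G); its kernel triple is a `(3k, k)` trisection of `1`
  obtain ⟨x₀, μ, hμ⟩ := hG N o (3 * k) k S hS
  have hK : IsGroupTrisection (3 * k) k (PUnit : Type) (groupGKTrisectionOf hS x₀ μ) :=
    (isGroupTrisection_groupGKTrisectionOf_holds.{0} N o (3 * k) k S hS x₀ μ).punit_of_subsingleton
  -- the hypothesis: stably trivial
  obtain ⟨n, m, hnm, hiso⟩ := hst₀ k _ hK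
  -- realise `K.stabilizeIter n` on the nose by a trisection of `N`
  obtain ⟨Sₙ, hₙ, xₙ, μₙ, hEq⟩ := hμ n
  rw [← hEq] at hiso
  -- the `(3 + 3m, 1 + m)`-trisection of `S⁴`, and rigidity
  obtain ⟨S', hS', x', μ', hiso'⟩ := hd m
  exact nonempty_diffeomorph_sphere_of_iso_cast hb o o' hₙ xₙ μₙ hS' x' μ' _ hiso' hnm
    (by omega) hiso

end StabilizableMarking

/-! ### 12. Cor. 6 with no lifting of automorphisms of `S_g`: a marking class and a
stabilisation relation

Throughout, `P X g k S h x₀ μ` is an arbitrary class of based markings of balanced Gay–Kirby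
trisections (intended: the *geometric* markings — read through a free basis of `π₁` of the
central surface minus a disc, the "datum" of `TrisectionStabilizationDatum.lean`, or induced by a
diffeomorphism from the model surface) and `Stab X n S Sₙ` an arbitrary relation (intended: "`Sₙ`
is obtained from `S` by `n` Gay–Kirby stabilisations", GK Def. 8).  The hypotheses used below are:

* `hP₀`  — every balanced trisection of a closed connected oriented smooth 4-manifold has a based
  marking in `P` (GK Def. 1: the central surface is a closed orientable surface of genus `g`);
* `hSt`  — it has an `n`-fold stabilisation in the sense of `Stab`, balanced of type
  `(g + 3n, k + n)`, for every `n` (GK Def. 8, Lemma 10);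
* `hStabP` — an `n`-fold stabilisation realises `(𝒢(S, x₀, μ)).stabilizeIter n` ON THE NOSE for
  every based marking `(x₀, μ)` of `S` in `P` (AGK Thm. 5: "connected sums of group trisections
  map to connected sums of 4-manifold trisections"; the shape of
  `exists_marking_groupGKTrisectionOf_eq_stabilize_datum`, iterated);
* `hStab_map` — `Stab` is transported along diffeomorphisms (tacit in GK Def. 8);
* `hGK11` — Gay–Kirby's Thm. 11 for `Stab`, needed ON `S⁴` ONLY: two balanced trisections of the
  round `S⁴` have `Stab`-stabilisations carried onto each other by a diffeomorphism of `S⁴`;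
* `hdP`  — the round `S⁴` has a balanced `(3, 1)`-trisection with a based marking in `P` whose
  kernel triple is `s4Kernels` (AGK Thm. 5: "the standard `(3, 1)`-trisection of `{1}` maps to
  the standard `(3, 1)`-trisection of `S⁴`"; GK §2);
* `heP`  — the map `ℳ` of AGK Thm. 5 with its marking recorded: every `(g, k)` group trisection
  `K` of a group `G` is, ON THE NOSE, the kernel triple of a balanced `(g, k)`-trisection of a closed
  connected oriented smooth 4-manifold for a based marking in `P` (in the printed construction the
  central surface is the parametrised model surface `Σ_g`, p. 1542).

No automorphism of `S_g` is ever lifted to the free group: with `heP` the marking realising `K` is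
geometric, so the algebraic stabilisations `K.stabilizeIter n` are realised by `hStabP` directly,
and isomorphisms of kernel triples only ever arise from two based markings of ONE trisection (§6).
-/

section MarkingClass

universe v

/-- **(d′) from the marking-class hypotheses.**  If (`hSt`) every balanced trisection of a closed
connected oriented smooth 4-manifold has an `n`-fold stabilisation in the sense of `Stab` for every
`n` (Gay–Kirby Def. 8 / Lemma 10), (`hStabP`) an `n`-fold stabilisation realises the `n`-fold
algebraic stabilisation of the kernel triple ON THE NOSE for every based marking in the class `P`
(Abrams–Gay–Kirby Thm. 5: "connected sums of group trisections map to connected sums of 4-manifold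
trisections"), and (`hdP`) the round `S⁴` carries a balanced `(3, 1)`-trisection with a based
marking in `P` whose kernel triple is `s4Kernels` (AGK Thm. 5: "the standard `(3, 1)`-trisection
of `{1}` maps to the standard `(3, 1)`-trisection of `S⁴`"), then the named fact (d′)
`sphere_gkTrisections` holds. [cite: AbramsGayKirby2018, Thm. 5 (p. 1541)]
[cite: GayKirby2016, Def. 8–9 and Lemma 10 (p. 3100)] -/
theorem sphere_gkTrisections_of_markingClass
    (P : ∀ (X : Type) [TopologicalSpace X] [ChartedSpace (EuclideanSpace ℝ (Fin 4)) X]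
      (g k : ℕ) (S : Fin 3 → Set X), IsBalancedGKTrisection X g k S → ∀ x₀ : centralSurface S,
      (SurfaceGroup g ≃* FundamentalGroup (centralSurface S) x₀) → Prop)
    (Stab : ∀ (X : Type) [TopologicalSpace X] [ChartedSpace (EuclideanSpace ℝ (Fin 4)) X],
      ℕ → (Fin 3 → Set X) → (Fin 3 → Set X) → Prop)
    (hSt : ∀ (X : Type) [TopologicalSpace X] [T2Space X] [SecondCountableTopology X]
      [ChartedSpace (EuclideanSpace ℝ (Fin 4)) X] [IsManifold (𝓡 4) ∞ X] [CompactSpace X]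
      [ConnectedSpace X] (_ : SmoothOrientation (𝓡 4) X) (g k : ℕ) (S : Fin 3 → Set X),
      IsBalancedGKTrisection X g k S → ∀ n : ℕ,
      ∃ Sₙ : Fin 3 → Set X, IsBalancedGKTrisection X (g + 3 * n) (k + n) Sₙ ∧ Stab X n S Sₙ)
    (hStabP : ∀ (X : Type) [TopologicalSpace X] [T2Space X] [SecondCountableTopology X]
      [ChartedSpace (EuclideanSpace ℝ (Fin 4)) X] [IsManifold (𝓡 4) ∞ X] [CompactSpace X]
      [ConnectedSpace X] (_ : SmoothOrientation (𝓡 4) X)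
      (g k n : ℕ) (S Sₙ : Fin 3 → Set X)
      (h : IsBalancedGKTrisection X g k S) (hₙ : IsBalancedGKTrisection X (g + 3 * n) (k + n) Sₙ),
      Stab X n S Sₙ → ∀ (x₀ : centralSurface S)
      (μ : SurfaceGroup g ≃* FundamentalGroup (centralSurface S) x₀), P X g k S h x₀ μ →
      ∃ (xₙ : centralSurface Sₙ)
        (μₙ : SurfaceGroup (g + 3 * n) ≃* FundamentalGroup (centralSurface Sₙ) xₙ),
        groupGKTrisectionOf hₙ xₙ μₙ = (groupGKTrisectionOf h x₀ μ).stabilizeIter n)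
    (hdP : ∃ (S : Fin 3 → Set (Metric.sphere (0 : EuclideanSpace ℝ (Fin 5)) 1))
      (h : IsBalancedGKTrisection (Metric.sphere (0 : EuclideanSpace ℝ (Fin 5)) 1) 3 1 S)
      (x₀ : centralSurface S) (μ : SurfaceGroup 3 ≃* FundamentalGroup (centralSurface S) x₀),
      P _ 3 1 S h x₀ μ ∧ groupGKTrisectionOf h x₀ μ = s4Kernels) :
    sphere_gkTrisections := by
  intro m
  obtain ⟨S, h, x₀, μ, hP, hK⟩ := hdP
  obtain ⟨o⟩ : Nonempty (SmoothOrientation (𝓡 4) (Metric.sphere (0 : EuclideanSpace ℝ (Fin 5)) 1)) :=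
    isOrientable_sphere_holds 4
  obtain ⟨Sₘ, hₘ, hst⟩ := hSt _ o 3 1 S h m
  obtain ⟨xₘ, μₘ, hEq⟩ := hStabP _ o 3 1 m S Sₘ h hₘ hst x₀ μ hP
  refine ⟨Sₘ, hₘ, xₘ, μₘ, ?_⟩
  rw [hEq, hK]
  exact TrisectionKernels.Iso.refl _

/-- **(G) of §11 from the marking-class hypotheses**: if (`hP₀`) every balanced trisection of a
closed connected oriented smooth 4-manifold admits a based marking in `P`, then with `hSt` and
`hStabP` as in `sphere_gkTrisections_of_markingClass` every such trisection has a based marking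
realised on the nose after every number of stabilisations (hypothesis (G) of
`spc4_of_forall_isStablyTrivial_of_stabilizableMarking`).  No automorphism of `S_g` is lifted.
[cite: AbramsGayKirby2018, Def. 3 (p. 1540) and Thm. 5 (p. 1541)] -/
theorem stabilizableMarking_of_markingClass
    (P : ∀ (X : Type) [TopologicalSpace X] [ChartedSpace (EuclideanSpace ℝ (Fin 4)) X]
      (g k : ℕ) (S : Fin 3 → Set X), IsBalancedGKTrisection X g k S → ∀ x₀ : centralSurface S,
      (SurfaceGroup g ≃* FundamentalGroup (centralSurface S) x₀) → Prop)
    (Stab : ∀ (X : Type) [TopologicalSpace X] [ChartedSpace (EuclideanSpace ℝ (Fin 4)) X],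
      ℕ → (Fin 3 → Set X) → (Fin 3 → Set X) → Prop)
    (hP₀ : ∀ (X : Type) [TopologicalSpace X] [T2Space X] [SecondCountableTopology X]
      [ChartedSpace (EuclideanSpace ℝ (Fin 4)) X] [IsManifold (𝓡 4) ∞ X] [CompactSpace X]
      [ConnectedSpace X] (_ : SmoothOrientation (𝓡 4) X) (g k : ℕ) (S : Fin 3 → Set X)
      (h : IsBalancedGKTrisection X g k S),
      ∃ (x₀ : centralSurface S) (μ : SurfaceGroup g ≃* FundamentalGroup (centralSurface S) x₀),
        P X g k S h x₀ μ)
    (hSt : ∀ (X : Type) [TopologicalSpace X] [T2Space X] [SecondCountableTopology X]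
      [ChartedSpace (EuclideanSpace ℝ (Fin 4)) X] [IsManifold (𝓡 4) ∞ X] [CompactSpace X]
      [ConnectedSpace X] (_ : SmoothOrientation (𝓡 4) X) (g k : ℕ) (S : Fin 3 → Set X),
      IsBalancedGKTrisection X g k S → ∀ n : ℕ,
      ∃ Sₙ : Fin 3 → Set X, IsBalancedGKTrisection X (g + 3 * n) (k + n) Sₙ ∧ Stab X n S Sₙ)
    (hStabP : ∀ (X : Type) [TopologicalSpace X] [T2Space X] [SecondCountableTopology X]
      [ChartedSpace (EuclideanSpace ℝ (Fin 4)) X] [IsManifold (𝓡 4) ∞ X] [CompactSpace X]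
      [ConnectedSpace X] (_ : SmoothOrientation (𝓡 4) X)
      (g k n : ℕ) (S Sₙ : Fin 3 → Set X)
      (h : IsBalancedGKTrisection X g k S) (hₙ : IsBalancedGKTrisection X (g + 3 * n) (k + n) Sₙ),
      Stab X n S Sₙ → ∀ (x₀ : centralSurface S)
      (μ : SurfaceGroup g ≃* FundamentalGroup (centralSurface S) x₀), P X g k S h x₀ μ →
      ∃ (xₙ : centralSurface Sₙ)
        (μₙ : SurfaceGroup (g + 3 * n) ≃* FundamentalGroup (centralSurface Sₙ) xₙ),
        groupGKTrisectionOf hₙ xₙ μₙ = (groupGKTrisectionOf h x₀ μ).stabilizeIter n)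
    (X : Type) [TopologicalSpace X] [T2Space X] [SecondCountableTopology X]
    [ChartedSpace (EuclideanSpace ℝ (Fin 4)) X] [IsManifold (𝓡 4) ∞ X] [CompactSpace X]
    [ConnectedSpace X] (o : SmoothOrientation (𝓡 4) X) (g k : ℕ) (S : Fin 3 → Set X)
    (h : IsBalancedGKTrisection X g k S) :
    ∃ (x₀ : centralSurface S) (μ : SurfaceGroup g ≃* FundamentalGroup (centralSurface S) x₀),
      ∀ n : ℕ, ∃ (S' : Fin 3 → Set X) (h' : IsBalancedGKTrisection X (g + 3 * n) (k + n) S')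
        (x₀' : centralSurface S')
        (μ' : SurfaceGroup (g + 3 * n) ≃* FundamentalGroup (centralSurface S') x₀'),
        groupGKTrisectionOf h' x₀' μ' = (groupGKTrisectionOf h x₀ μ).stabilizeIter n := by
  obtain ⟨x₀, μ, hμ⟩ := hP₀ X o g k S h
  refine ⟨x₀, μ, fun n => ?_⟩
  obtain ⟨Sₙ, hₙ, hst⟩ := hSt X o g k S h n
  obtain ⟨xₙ, μₙ, hEq⟩ := hStabP X o g k n S Sₙ h hₙ hst x₀ μ hμ
  exact ⟨Sₙ, hₙ, xₙ, μₙ, hEq⟩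

/-- **Abrams–Gay–Kirby 2018, Cor. 6, direction "every `(3k, k)`-trisection of the trivial group is
stably trivial ⇒ SPC4", from Gay–Kirby Thm. 4 (`hGK`), rigidity (b′) (`hb`) and the marking-class
hypotheses `hP₀`, `hSt`, `hStabP`, `hdP` of the section docstring, at every universe.**  By §11
(`spc4_of_forall_isStablyTrivial_of_stabilizableMarking`) with (d′) and (G) supplied by
`sphere_gkTrisections_of_markingClass` and `stabilizableMarking_of_markingClass`.  Printed proof,
p. 1541: a homotopy 4-sphere `M` is simply connected with `χ(M) = 2`, so a trisection of `M`
(GK Thm. 4) has `g = 3k`; its group trisection is a `(3k, k)`-trisection of `{1}`, stably trivial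
by hypothesis, and `M ≅ S⁴` by Thm. 5. [cite: AbramsGayKirby2018, Cor. 6 (p. 1541); Thm. 5 (p. 1541)]
[cite: GayKirby2016, Def. 8 and Lemma 10 (p. 3100)] -/
theorem spc4_of_forall_isStablyTrivial_of_markingClass
    (hGK : exists_isBalancedGKTrisection.{0})
    (hb : diffeomorph_of_iso_groupGKTrisectionOf.{0})
    (P : ∀ (X : Type) [TopologicalSpace X] [ChartedSpace (EuclideanSpace ℝ (Fin 4)) X]
      (g k : ℕ) (S : Fin 3 → Set X), IsBalancedGKTrisection X g k S → ∀ x₀ : centralSurface S,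
      (SurfaceGroup g ≃* FundamentalGroup (centralSurface S) x₀) → Prop)
    (Stab : ∀ (X : Type) [TopologicalSpace X] [ChartedSpace (EuclideanSpace ℝ (Fin 4)) X],
      ℕ → (Fin 3 → Set X) → (Fin 3 → Set X) → Prop)
    (hP₀ : ∀ (X : Type) [TopologicalSpace X] [T2Space X] [SecondCountableTopology X]
      [ChartedSpace (EuclideanSpace ℝ (Fin 4)) X] [IsManifold (𝓡 4) ∞ X] [CompactSpace X]
      [ConnectedSpace X] (_ : SmoothOrientation (𝓡 4) X) (g k : ℕ) (S : Fin 3 → Set X)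
      (h : IsBalancedGKTrisection X g k S),
      ∃ (x₀ : centralSurface S) (μ : SurfaceGroup g ≃* FundamentalGroup (centralSurface S) x₀),
        P X g k S h x₀ μ)
    (hSt : ∀ (X : Type) [TopologicalSpace X] [T2Space X] [SecondCountableTopology X]
      [ChartedSpace (EuclideanSpace ℝ (Fin 4)) X] [IsManifold (𝓡 4) ∞ X] [CompactSpace X]
      [ConnectedSpace X] (_ : SmoothOrientation (𝓡 4) X) (g k : ℕ) (S : Fin 3 → Set X),
      IsBalancedGKTrisection X g k S → ∀ n : ℕ,
      ∃ Sₙ : Fin 3 → Set X, IsBalancedGKTrisection X (g + 3 * n) (k + n) Sₙ ∧ Stab X n S Sₙ)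
    (hStabP : ∀ (X : Type) [TopologicalSpace X] [T2Space X] [SecondCountableTopology X]
      [ChartedSpace (EuclideanSpace ℝ (Fin 4)) X] [IsManifold (𝓡 4) ∞ X] [CompactSpace X]
      [ConnectedSpace X] (_ : SmoothOrientation (𝓡 4) X)
      (g k n : ℕ) (S Sₙ : Fin 3 → Set X)
      (h : IsBalancedGKTrisection X g k S) (hₙ : IsBalancedGKTrisection X (g + 3 * n) (k + n) Sₙ),
      Stab X n S Sₙ → ∀ (x₀ : centralSurface S)
      (μ : SurfaceGroup g ≃* FundamentalGroup (centralSurface S) x₀), P X g k S h x₀ μ →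
      ∃ (xₙ : centralSurface Sₙ)
        (μₙ : SurfaceGroup (g + 3 * n) ≃* FundamentalGroup (centralSurface Sₙ) xₙ),
        groupGKTrisectionOf hₙ xₙ μₙ = (groupGKTrisectionOf h x₀ μ).stabilizeIter n)
    (hdP : ∃ (S : Fin 3 → Set (Metric.sphere (0 : EuclideanSpace ℝ (Fin 5)) 1))
      (h : IsBalancedGKTrisection (Metric.sphere (0 : EuclideanSpace ℝ (Fin 5)) 1) 3 1 S)
      (x₀ : centralSurface S) (μ : SurfaceGroup 3 ≃* FundamentalGroup (centralSurface S) x₀),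
      P _ 3 1 S h x₀ μ ∧ groupGKTrisectionOf h x₀ μ = s4Kernels)
    (hst : ∀ (k : ℕ) (K : TrisectionKernels (3 * k)),
      IsGroupTrisection (3 * k) k (PUnit : Type u) K → K.IsStablyTrivial)
    (M : Type v) [TopologicalSpace M] [T2Space M] [SecondCountableTopology M] :
    ContinuousMap.HomotopyEquiv.NonemptyDiffeomorphSphere M 4 :=
  spc4_of_forall_isStablyTrivial_of_stabilizableMarking hGK hb
    (sphere_gkTrisections_of_markingClass P Stab hSt hStabP hdP)
    (stabilizableMarking_of_markingClass P Stab hP₀ hSt hStabP) hst M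

/-- **Abrams–Gay–Kirby 2018, Cor. 6, direction "SPC4 ⇒ every `(3k, k)`-trisection of the trivial
group is stably trivial", with Gay–Kirby's Thm. 11 used on `S⁴` only and no lifting of
automorphisms of `S_g`.**  Hypotheses (section docstring): `hStabP` (AGK Thm. 5, stabilisation
compatibility on the nose for markings in `P`), `hStab_map`, `hGK11` (GK Thm. 11 for trisections
of the round `S⁴`), `hdP` (the standard `P`-marked `(3, 1)`-trisection of `S⁴`) and `heP` (the map
`ℳ` with its `P`-marking); SPC4 in any universe `v`, the trivial group in any universe `u`.
Printed proof (p. 1541 with the last paragraph of the proof of Thm. 5, p. 1542): a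
`(3k, k)`-trisection `K` of `{1}` is `𝒢` of a `P`-marked trisected closed 4-manifold `X` (`heP`),
which is simply connected ((a′), `isGroupTrisection_groupGKTrisectionOf_holds`) with `χ = 2`, hence
a homotopy `S⁴` ((h), `spc4.S10`, both proved), hence `X ≅ S⁴` (SPC4).  Carry the trisection to
`S⁴`; by GK Thm. 11 some `n`-fold stabilisation of it is carried by a diffeomorphism `ψ` of `S⁴`
onto an `n'`-fold stabilisation of the standard `(3, 1)`-trisection.  Pulled back to `X`
(`hStab_map`, `IsGKTrisection.image_diffeomorph`) the first realises `K.stabilizeIter n` on the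
nose for the `P`-marking (`hStabP`); pushed forward along `ψ ∘ φ` the kernel triple is unchanged
(`exists_groupGKTrisectionOf_eq_of_homeomorph`, AGK p. 1540); the second realises
`s4Kernels.stabilizeIter n'` (`hdP`, `hStabP`); two based markings of one trisection give
isomorphic kernel triples (`groupGKTrisectionOf_iso_cast`, §6).  Hence `K` is stably trivial.
[cite: AbramsGayKirby2018, Cor. 6 (p. 1541); Thm. 5 (p. 1541) and its proof (p. 1542); p. 1540]
[cite: GayKirby2016, Thm. 11 (p. 3101)] -/
theorem forall_isStablyTrivial_of_spc4_of_markingClass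
    (P : ∀ (X : Type) [TopologicalSpace X] [ChartedSpace (EuclideanSpace ℝ (Fin 4)) X]
      (g k : ℕ) (S : Fin 3 → Set X), IsBalancedGKTrisection X g k S → ∀ x₀ : centralSurface S,
      (SurfaceGroup g ≃* FundamentalGroup (centralSurface S) x₀) → Prop)
    (Stab : ∀ (X : Type) [TopologicalSpace X] [ChartedSpace (EuclideanSpace ℝ (Fin 4)) X],
      ℕ → (Fin 3 → Set X) → (Fin 3 → Set X) → Prop)
    (hStabP : ∀ (X : Type) [TopologicalSpace X] [T2Space X] [SecondCountableTopology X]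
      [ChartedSpace (EuclideanSpace ℝ (Fin 4)) X] [IsManifold (𝓡 4) ∞ X] [CompactSpace X]
      [ConnectedSpace X] (_ : SmoothOrientation (𝓡 4) X)
      (g k n : ℕ) (S Sₙ : Fin 3 → Set X)
      (h : IsBalancedGKTrisection X g k S) (hₙ : IsBalancedGKTrisection X (g + 3 * n) (k + n) Sₙ),
      Stab X n S Sₙ → ∀ (x₀ : centralSurface S)
      (μ : SurfaceGroup g ≃* FundamentalGroup (centralSurface S) x₀), P X g k S h x₀ μ →
      ∃ (xₙ : centralSurface Sₙ)
        (μₙ : SurfaceGroup (g + 3 * n) ≃* FundamentalGroup (centralSurface Sₙ) xₙ),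
        groupGKTrisectionOf hₙ xₙ μₙ = (groupGKTrisectionOf h x₀ μ).stabilizeIter n)
    (hStab_map : ∀ (X : Type) [TopologicalSpace X] [T2Space X] [SecondCountableTopology X]
      [ChartedSpace (EuclideanSpace ℝ (Fin 4)) X] [IsManifold (𝓡 4) ∞ X] [CompactSpace X]
      [ConnectedSpace X] (_ : SmoothOrientation (𝓡 4) X)
      (X' : Type) [TopologicalSpace X'] [T2Space X'] [SecondCountableTopology X']
      [ChartedSpace (EuclideanSpace ℝ (Fin 4)) X'] [IsManifold (𝓡 4) ∞ X'] [CompactSpace X']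
      [ConnectedSpace X'] (_ : SmoothOrientation (𝓡 4) X')
      (φ : X ≃ₘ⟮𝓡 4, 𝓡 4⟯ X') (n : ℕ) (S Sₙ : Fin 3 → Set X),
      Stab X n S Sₙ → Stab X' n (fun i => φ '' S i) (fun i => φ '' Sₙ i))
    (hGK11 : ∀ (g k g' k' : ℕ) (S S' : Fin 3 → Set (Metric.sphere (0 : EuclideanSpace ℝ (Fin 5)) 1)),
      IsBalancedGKTrisection _ g k S → IsBalancedGKTrisection _ g' k' S' →
      ∃ (n n' : ℕ) (_ : g' + 3 * n' = g + 3 * n)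
        (Sₙ S'ₙ : Fin 3 → Set (Metric.sphere (0 : EuclideanSpace ℝ (Fin 5)) 1)),
        IsBalancedGKTrisection _ (g + 3 * n) (k + n) Sₙ ∧
        IsBalancedGKTrisection _ (g' + 3 * n') (k' + n') S'ₙ ∧
        Stab _ n S Sₙ ∧ Stab _ n' S' S'ₙ ∧
        ∃ ψ : (Metric.sphere (0 : EuclideanSpace ℝ (Fin 5)) 1) ≃ₘ⟮𝓡 4, 𝓡 4⟯
          (Metric.sphere (0 : EuclideanSpace ℝ (Fin 5)) 1), ∀ i, ψ '' Sₙ i = S'ₙ i)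
    (hdP : ∃ (S : Fin 3 → Set (Metric.sphere (0 : EuclideanSpace ℝ (Fin 5)) 1))
      (h : IsBalancedGKTrisection (Metric.sphere (0 : EuclideanSpace ℝ (Fin 5)) 1) 3 1 S)
      (x₀ : centralSurface S) (μ : SurfaceGroup 3 ≃* FundamentalGroup (centralSurface S) x₀),
      P _ 3 1 S h x₀ μ ∧ groupGKTrisectionOf h x₀ μ = s4Kernels)
    (heP : ∀ (g k : ℕ) (G : Type) [Group G] (K : TrisectionKernels g), IsGroupTrisection g k G K →
      ∃ (X : Type) (_ : TopologicalSpace X) (_ : T2Space X) (_ : SecondCountableTopology X)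
        (_ : ChartedSpace (EuclideanSpace ℝ (Fin 4)) X) (_ : IsManifold (𝓡 4) ∞ X)
        (_ : CompactSpace X) (_ : ConnectedSpace X) (_ : SmoothOrientation (𝓡 4) X)
        (S : Fin 3 → Set X) (h : IsBalancedGKTrisection X g k S) (x₀ : centralSurface S)
        (μ : SurfaceGroup g ≃* FundamentalGroup (centralSurface S) x₀),
        P X g k S h x₀ μ ∧ groupGKTrisectionOf h x₀ μ = K)
    (spc4 : ∀ (M : Type v) [TopologicalSpace M] [T2Space M] [SecondCountableTopology M],
      ContinuousMap.HomotopyEquiv.NonemptyDiffeomorphSphere M 4)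
    (k : ℕ) (K : TrisectionKernels (3 * k)) (hK : IsGroupTrisection (3 * k) k (PUnit : Type u) K) :
    K.IsStablyTrivial := by
  have spc4₀ : ∀ (M : Type) [TopologicalSpace M] [T2Space M] [SecondCountableTopology M],
      ContinuousMap.HomotopyEquiv.NonemptyDiffeomorphSphere M 4 := spc4_univ_of_univ spc4
  have hK₀ : IsGroupTrisection (3 * k) k (PUnit : Type) K := hK.punit_of_subsingleton
  -- realise `K` on the nose by a `P`-marked trisected closed connected oriented smooth `X` (`ℳ`)
  obtain ⟨X, _, _, _, _, _, _, _, o, S, hS, x₀, μ, hPμ, hKμ⟩ := heP (3 * k) k PUnit K hK₀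
  -- `π₁(X, x₀) = 1`, hence `X` is simply connected
  have hπ := isGroupTrisection_groupGKTrisectionOf_holds.{0} X o (3 * k) k S hS x₀ μ
  rw [hKμ] at hπ
  haveI : Subsingleton (FundamentalGroup X (x₀ : X)) := hπ.subsingleton_of_subsingleton hK₀
  haveI : SimplyConnectedSpace X := simplyConnectedSpace_of_subsingleton_fundamentalGroup (x₀ : X)
  -- `χ(X) = 2`, so `X ≃ₕ S⁴` ((h) and `spc4.S10`, proved) and `X ≃ₘ S⁴` under SPC4
  obtain ⟨e⟩ := nonempty_homotopyEquiv_sphere_of_gkTrisection_three_mul_holds o hS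
  obtain ⟨φ⟩ := spc4₀ X inferInstance inferInstance e
  obtain ⟨o'⟩ : Nonempty (SmoothOrientation (𝓡 4) (Metric.sphere (0 : EuclideanSpace ℝ (Fin 5)) 1)) :=
    isOrientable_sphere_holds 4
  -- the standard `P`-marked `(3, 1)`-trisection of `S⁴`
  obtain ⟨T₀, hT₀, y₀, ν₀, hPν₀, hKν₀⟩ := hdP
  -- push `S` forward to `S⁴` and stabilise there until isotopic (Gay–Kirby Thm. 11 on `S⁴`)
  have hT : IsBalancedGKTrisection _ (3 * k) k (fun i => φ '' S i) :=
    hS.isGKTrisection.image_diffeomorph φ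
  obtain ⟨n, n', hnn, Tₙ, T'ₙ, hTₙ, hT'ₙ, hst, hst', ψ, hψ⟩ :=
    hGK11 (3 * k) k 3 1 (fun i => φ '' S i) T₀ hT hT₀
  -- pull the stabilisation `Tₙ` of `φ(S)` back to `X`: it is a stabilisation of `S`
  have hSS : (fun i => φ.symm '' (φ '' S i)) = S := funext fun i => φ.symm_image_image (S i)
  have hstX : Stab X n S (fun i => φ.symm '' Tₙ i) := by
    have H := hStab_map _ o' X o φ.symm n (fun i => φ '' S i) Tₙ hst
    rw [hSS] at H
    exact H
  have hTₙX : IsBalancedGKTrisection X (3 * k + 3 * n) (k + n) (fun i => φ.symm '' Tₙ i) :=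
    hTₙ.isGKTrisection.image_diffeomorph φ.symm
  -- the `P`-marking of `S` is realised on the nose on that stabilisation (AGK Thm. 5)
  obtain ⟨xₙ, μₙ, hEq⟩ := hStabP X o (3 * k) k n S _ hS hTₙX hstX x₀ μ hPμ
  -- push the based marking forward along `ψ ∘ φ` onto `ψ(Tₙ) = T'ₙ'` (AGK p. 1540)
  have himg : IsGKTrisection _ (3 * k + 3 * n) (fun _ => k + n)
      (fun i => (φ.trans ψ).toHomeomorph '' (φ.symm '' Tₙ i)) :=
    hTₙX.isGKTrisection.image_diffeomorph (φ.trans ψ)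
  obtain ⟨y, ν, -, hν⟩ := exists_groupGKTrisectionOf_eq_of_homeomorph hTₙX.isGKTrisection
    (φ.trans ψ).toHomeomorph himg xₙ μₙ
  have hTT : (fun i => (φ.trans ψ).toHomeomorph '' (φ.symm '' Tₙ i)) = T'ₙ := by
    funext i
    rw [← hψ i, Diffeomorph.coe_toHomeomorph, Diffeomorph.coe_trans, Set.image_comp,
      φ.image_symm_image]
  subst hTT
  -- the `S⁴` side: `T'ₙ'` realises `s4Kernels.stabilizeIter n'` (AGK Thm. 5 for the `P`-marking)
  obtain ⟨y', ν', hν'⟩ := hStabP _ o' 3 1 n' T₀ _ hT₀ hT'ₙ hst' y₀ ν₀ hPν₀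
  -- two based markings of ONE trisection of `S⁴`: isomorphic kernel triples (§6)
  have iso := groupGKTrisectionOf_iso_cast hnn himg hT'ₙ.isGKTrisection y y' ν ν'
  rw [hν, hEq, hKμ, hν', hKν₀] at iso
  exact ⟨n, n', hnn, iso⟩

/-- **Abrams–Gay–Kirby 2018, Cor. 6 — the named fact (f) `spc4_iff_forall_isStablyTrivial` at
every universe — from a leaf set WITHOUT Nielsen's lifting theorem, (c′)-for-all-markings or (i):**
Gay–Kirby Thm. 4 (`hGK`), rigidity (b′) (`hb`), and the marking-class hypotheses `hP₀`, `hSt`,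
`hStabP`, `hStab_map`, `hGK11` (on `S⁴` only), `hdP`, `heP` of the section docstring.  Compared
with the five-leaf assembly of §9 (`{GK Thm. 4, (b′), (c′), (e′), (i)}`): (c′) for ALL markings —
which is the geometric stabilisation for one marking plus Nielsen's theorem (header of
`TrisectionFunctorGKStabilization.lean`) — is replaced by the geometric statement `hStabP` for the
markings in `P`; (e′) by `heP`, i.e. (e′) remembering that the marking produced by `ℳ` lies in `P`
and realises `K` on the nose (as in print, where markings ARE parametrisations by the model
surface); and (i) by Gay–Kirby's Thm. 11 on `S⁴`.  Dehn–Nielsen–Baer survives only inside (b′),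
where an abstract isomorphism of group trisections must become a diffeomorphism (AGK Thm. 5,
`ℳ ∘ 𝒢 = id`).  The two directions are `forall_isStablyTrivial_of_spc4_of_markingClass` and
`spc4_of_forall_isStablyTrivial_of_markingClass`. [cite: AbramsGayKirby2018, Cor. 6 (p. 1541); Thm. 5 (p. 1541)]
[cite: GayKirby2016, Thm. 4, Def. 8, Lemma 10 and Thm. 11] -/
theorem spc4_iff_forall_isStablyTrivial_of_markingClass
    (hGK : exists_isBalancedGKTrisection.{0})
    (hb : diffeomorph_of_iso_groupGKTrisectionOf.{0})
    (P : ∀ (X : Type) [TopologicalSpace X] [ChartedSpace (EuclideanSpace ℝ (Fin 4)) X]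
      (g k : ℕ) (S : Fin 3 → Set X), IsBalancedGKTrisection X g k S → ∀ x₀ : centralSurface S,
      (SurfaceGroup g ≃* FundamentalGroup (centralSurface S) x₀) → Prop)
    (Stab : ∀ (X : Type) [TopologicalSpace X] [ChartedSpace (EuclideanSpace ℝ (Fin 4)) X],
      ℕ → (Fin 3 → Set X) → (Fin 3 → Set X) → Prop)
    (hP₀ : ∀ (X : Type) [TopologicalSpace X] [T2Space X] [SecondCountableTopology X]
      [ChartedSpace (EuclideanSpace ℝ (Fin 4)) X] [IsManifold (𝓡 4) ∞ X] [CompactSpace X]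
      [ConnectedSpace X] (_ : SmoothOrientation (𝓡 4) X) (g k : ℕ) (S : Fin 3 → Set X)
      (h : IsBalancedGKTrisection X g k S),
      ∃ (x₀ : centralSurface S) (μ : SurfaceGroup g ≃* FundamentalGroup (centralSurface S) x₀),
        P X g k S h x₀ μ)
    (hSt : ∀ (X : Type) [TopologicalSpace X] [T2Space X] [SecondCountableTopology X]
      [ChartedSpace (EuclideanSpace ℝ (Fin 4)) X] [IsManifold (𝓡 4) ∞ X] [CompactSpace X]
      [ConnectedSpace X] (_ : SmoothOrientation (𝓡 4) X) (g k : ℕ) (S : Fin 3 → Set X),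
      IsBalancedGKTrisection X g k S → ∀ n : ℕ,
      ∃ Sₙ : Fin 3 → Set X, IsBalancedGKTrisection X (g + 3 * n) (k + n) Sₙ ∧ Stab X n S Sₙ)
    (hStabP : ∀ (X : Type) [TopologicalSpace X] [T2Space X] [SecondCountableTopology X]
      [ChartedSpace (EuclideanSpace ℝ (Fin 4)) X] [IsManifold (𝓡 4) ∞ X] [CompactSpace X]
      [ConnectedSpace X] (_ : SmoothOrientation (𝓡 4) X)
      (g k n : ℕ) (S Sₙ : Fin 3 → Set X)
      (h : IsBalancedGKTrisection X g k S) (hₙ : IsBalancedGKTrisection X (g + 3 * n) (k + n) Sₙ),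
      Stab X n S Sₙ → ∀ (x₀ : centralSurface S)
      (μ : SurfaceGroup g ≃* FundamentalGroup (centralSurface S) x₀), P X g k S h x₀ μ →
      ∃ (xₙ : centralSurface Sₙ)
        (μₙ : SurfaceGroup (g + 3 * n) ≃* FundamentalGroup (centralSurface Sₙ) xₙ),
        groupGKTrisectionOf hₙ xₙ μₙ = (groupGKTrisectionOf h x₀ μ).stabilizeIter n)
    (hStab_map : ∀ (X : Type) [TopologicalSpace X] [T2Space X] [SecondCountableTopology X]
      [ChartedSpace (EuclideanSpace ℝ (Fin 4)) X] [IsManifold (𝓡 4) ∞ X] [CompactSpace X]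
      [ConnectedSpace X] (_ : SmoothOrientation (𝓡 4) X)
      (X' : Type) [TopologicalSpace X'] [T2Space X'] [SecondCountableTopology X']
      [ChartedSpace (EuclideanSpace ℝ (Fin 4)) X'] [IsManifold (𝓡 4) ∞ X'] [CompactSpace X']
      [ConnectedSpace X'] (_ : SmoothOrientation (𝓡 4) X')
      (φ : X ≃ₘ⟮𝓡 4, 𝓡 4⟯ X') (n : ℕ) (S Sₙ : Fin 3 → Set X),
      Stab X n S Sₙ → Stab X' n (fun i => φ '' S i) (fun i => φ '' Sₙ i))
    (hGK11 : ∀ (g k g' k' : ℕ) (S S' : Fin 3 → Set (Metric.sphere (0 : EuclideanSpace ℝ (Fin 5)) 1)),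
      IsBalancedGKTrisection _ g k S → IsBalancedGKTrisection _ g' k' S' →
      ∃ (n n' : ℕ) (_ : g' + 3 * n' = g + 3 * n)
        (Sₙ S'ₙ : Fin 3 → Set (Metric.sphere (0 : EuclideanSpace ℝ (Fin 5)) 1)),
        IsBalancedGKTrisection _ (g + 3 * n) (k + n) Sₙ ∧
        IsBalancedGKTrisection _ (g' + 3 * n') (k' + n') S'ₙ ∧
        Stab _ n S Sₙ ∧ Stab _ n' S' S'ₙ ∧
        ∃ ψ : (Metric.sphere (0 : EuclideanSpace ℝ (Fin 5)) 1) ≃ₘ⟮𝓡 4, 𝓡 4⟯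
          (Metric.sphere (0 : EuclideanSpace ℝ (Fin 5)) 1), ∀ i, ψ '' Sₙ i = S'ₙ i)
    (hdP : ∃ (S : Fin 3 → Set (Metric.sphere (0 : EuclideanSpace ℝ (Fin 5)) 1))
      (h : IsBalancedGKTrisection (Metric.sphere (0 : EuclideanSpace ℝ (Fin 5)) 1) 3 1 S)
      (x₀ : centralSurface S) (μ : SurfaceGroup 3 ≃* FundamentalGroup (centralSurface S) x₀),
      P _ 3 1 S h x₀ μ ∧ groupGKTrisectionOf h x₀ μ = s4Kernels)
    (heP : ∀ (g k : ℕ) (G : Type) [Group G] (K : TrisectionKernels g), IsGroupTrisection g k G K →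
      ∃ (X : Type) (_ : TopologicalSpace X) (_ : T2Space X) (_ : SecondCountableTopology X)
        (_ : ChartedSpace (EuclideanSpace ℝ (Fin 4)) X) (_ : IsManifold (𝓡 4) ∞ X)
        (_ : CompactSpace X) (_ : ConnectedSpace X) (_ : SmoothOrientation (𝓡 4) X)
        (S : Fin 3 → Set X) (h : IsBalancedGKTrisection X g k S) (x₀ : centralSurface S)
        (μ : SurfaceGroup g ≃* FundamentalGroup (centralSurface S) x₀),
        P X g k S h x₀ μ ∧ groupGKTrisectionOf h x₀ μ = K) :
    spc4_iff_forall_isStablyTrivial.{u} :=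
  ⟨fun spc4 k K hK => forall_isStablyTrivial_of_spc4_of_markingClass P Stab hStabP hStab_map
      hGK11 hdP heP spc4 k K hK,
    fun hst M _ _ _ => spc4_of_forall_isStablyTrivial_of_markingClass hGK hb P Stab hP₀ hSt
      hStabP hdP hst M⟩

/-- The same with Gay–Kirby's Thm. 11 in its printed generality — for every closed connected
oriented smooth 4-manifold `X : Type` and the relation `Stab` (the hypothesis `hGK11` of §7,
`stablyIso_groupGKTrisectionOf_of_diffeomorphic_of_uniqueness`, at universe `0`) — of which only
the instance `X = S⁴` is used. [cite: AbramsGayKirby2018, Cor. 6 (p. 1541)]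
[cite: GayKirby2016, Thm. 11 (p. 3101)] -/
theorem spc4_iff_forall_isStablyTrivial_of_markingClass'
    (hGK : exists_isBalancedGKTrisection.{0})
    (hb : diffeomorph_of_iso_groupGKTrisectionOf.{0})
    (P : ∀ (X : Type) [TopologicalSpace X] [ChartedSpace (EuclideanSpace ℝ (Fin 4)) X]
      (g k : ℕ) (S : Fin 3 → Set X), IsBalancedGKTrisection X g k S → ∀ x₀ : centralSurface S,
      (SurfaceGroup g ≃* FundamentalGroup (centralSurface S) x₀) → Prop)
    (Stab : ∀ (X : Type) [TopologicalSpace X] [ChartedSpace (EuclideanSpace ℝ (Fin 4)) X],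
      ℕ → (Fin 3 → Set X) → (Fin 3 → Set X) → Prop)
    (hP₀ : ∀ (X : Type) [TopologicalSpace X] [T2Space X] [SecondCountableTopology X]
      [ChartedSpace (EuclideanSpace ℝ (Fin 4)) X] [IsManifold (𝓡 4) ∞ X] [CompactSpace X]
      [ConnectedSpace X] (_ : SmoothOrientation (𝓡 4) X) (g k : ℕ) (S : Fin 3 → Set X)
      (h : IsBalancedGKTrisection X g k S),
      ∃ (x₀ : centralSurface S) (μ : SurfaceGroup g ≃* FundamentalGroup (centralSurface S) x₀),
        P X g k S h x₀ μ)
    (hSt : ∀ (X : Type) [TopologicalSpace X] [T2Space X] [SecondCountableTopology X]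
      [ChartedSpace (EuclideanSpace ℝ (Fin 4)) X] [IsManifold (𝓡 4) ∞ X] [CompactSpace X]
      [ConnectedSpace X] (_ : SmoothOrientation (𝓡 4) X) (g k : ℕ) (S : Fin 3 → Set X),
      IsBalancedGKTrisection X g k S → ∀ n : ℕ,
      ∃ Sₙ : Fin 3 → Set X, IsBalancedGKTrisection X (g + 3 * n) (k + n) Sₙ ∧ Stab X n S Sₙ)
    (hStabP : ∀ (X : Type) [TopologicalSpace X] [T2Space X] [SecondCountableTopology X]
      [ChartedSpace (EuclideanSpace ℝ (Fin 4)) X] [IsManifold (𝓡 4) ∞ X] [CompactSpace X]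
      [ConnectedSpace X] (_ : SmoothOrientation (𝓡 4) X)
      (g k n : ℕ) (S Sₙ : Fin 3 → Set X)
      (h : IsBalancedGKTrisection X g k S) (hₙ : IsBalancedGKTrisection X (g + 3 * n) (k + n) Sₙ),
      Stab X n S Sₙ → ∀ (x₀ : centralSurface S)
      (μ : SurfaceGroup g ≃* FundamentalGroup (centralSurface S) x₀), P X g k S h x₀ μ →
      ∃ (xₙ : centralSurface Sₙ)
        (μₙ : SurfaceGroup (g + 3 * n) ≃* FundamentalGroup (centralSurface Sₙ) xₙ),
        groupGKTrisectionOf hₙ xₙ μₙ = (groupGKTrisectionOf h x₀ μ).stabilizeIter n)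
    (hStab_map : ∀ (X : Type) [TopologicalSpace X] [T2Space X] [SecondCountableTopology X]
      [ChartedSpace (EuclideanSpace ℝ (Fin 4)) X] [IsManifold (𝓡 4) ∞ X] [CompactSpace X]
      [ConnectedSpace X] (_ : SmoothOrientation (𝓡 4) X)
      (X' : Type) [TopologicalSpace X'] [T2Space X'] [SecondCountableTopology X']
      [ChartedSpace (EuclideanSpace ℝ (Fin 4)) X'] [IsManifold (𝓡 4) ∞ X'] [CompactSpace X']
      [ConnectedSpace X'] (_ : SmoothOrientation (𝓡 4) X')
      (φ : X ≃ₘ⟮𝓡 4, 𝓡 4⟯ X') (n : ℕ) (S Sₙ : Fin 3 → Set X),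
      Stab X n S Sₙ → Stab X' n (fun i => φ '' S i) (fun i => φ '' Sₙ i))
    (hGK11 : ∀ (X : Type) [TopologicalSpace X] [T2Space X] [SecondCountableTopology X]
      [ChartedSpace (EuclideanSpace ℝ (Fin 4)) X] [IsManifold (𝓡 4) ∞ X] [CompactSpace X]
      [ConnectedSpace X] (_ : SmoothOrientation (𝓡 4) X)
      (g k g' k' : ℕ) (S S' : Fin 3 → Set X),
      IsBalancedGKTrisection X g k S → IsBalancedGKTrisection X g' k' S' →
      ∃ (n n' : ℕ) (_ : g' + 3 * n' = g + 3 * n) (Sₙ S'ₙ : Fin 3 → Set X),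
        IsBalancedGKTrisection X (g + 3 * n) (k + n) Sₙ ∧
        IsBalancedGKTrisection X (g' + 3 * n') (k' + n') S'ₙ ∧
        Stab X n S Sₙ ∧ Stab X n' S' S'ₙ ∧
        ∃ ψ : X ≃ₘ⟮𝓡 4, 𝓡 4⟯ X, ∀ i, ψ '' Sₙ i = S'ₙ i)
    (hdP : ∃ (S : Fin 3 → Set (Metric.sphere (0 : EuclideanSpace ℝ (Fin 5)) 1))
      (h : IsBalancedGKTrisection (Metric.sphere (0 : EuclideanSpace ℝ (Fin 5)) 1) 3 1 S)
      (x₀ : centralSurface S) (μ : SurfaceGroup 3 ≃* FundamentalGroup (centralSurface S) x₀),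
      P _ 3 1 S h x₀ μ ∧ groupGKTrisectionOf h x₀ μ = s4Kernels)
    (heP : ∀ (g k : ℕ) (G : Type) [Group G] (K : TrisectionKernels g), IsGroupTrisection g k G K →
      ∃ (X : Type) (_ : TopologicalSpace X) (_ : T2Space X) (_ : SecondCountableTopology X)
        (_ : ChartedSpace (EuclideanSpace ℝ (Fin 4)) X) (_ : IsManifold (𝓡 4) ∞ X)
        (_ : CompactSpace X) (_ : ConnectedSpace X) (_ : SmoothOrientation (𝓡 4) X)
        (S : Fin 3 → Set X) (h : IsBalancedGKTrisection X g k S) (x₀ : centralSurface S)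
        (μ : SurfaceGroup g ≃* FundamentalGroup (centralSurface S) x₀),
        P X g k S h x₀ μ ∧ groupGKTrisectionOf h x₀ μ = K) :
    spc4_iff_forall_isStablyTrivial.{u} := by
  refine spc4_iff_forall_isStablyTrivial_of_markingClass hGK hb P Stab hP₀ hSt hStabP hStab_map
    (fun g k g' k' S S' h h' => ?_) hdP heP
  obtain ⟨o'⟩ : Nonempty (SmoothOrientation (𝓡 4) (Metric.sphere (0 : EuclideanSpace ℝ (Fin 5)) 1)) :=
    isOrientable_sphere_holds 4
  exact hGK11 _ o' g k g' k' S S' h h'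

end MarkingClass

end Literature.Topology.FourManifolds

end
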